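import Mathlib.Algebra.BigOperators.Fin
import Mathlib.Data.Fin.Tuple.Basic
import Mathlib.Data.Finset.Sort
import Mathlib.Data.Fintype.Perm
import Mathlib.Data.Fintype.Sum
import Mathlib.Analysis.SpecialFunctions.Pow.Real
import Mathlib.Analysis.SpecificLimits.Normed
import Mathlib.Data.Nat.Choose.Basic
import Mathlib.Order.Filter.AtTopBot.Basic
import Literature.ModelTheory.FiniteModelTheory.SymmetricCircuitCountingWidth
import Literature.Computability.Complexity.CircuitReduce
import Literature.Computability.Complexity.SupportTheorem
import HarnessLib

/-!
# Supports of size `k` give counting width `O(k)` — proof (Anderson–Dawar; Dawar–Wilsenach)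

Topic `Literature/ModelTheory/FiniteModelTheory`. This file DISCHARGES the named fact
`AndersonDawar2016_supports_countingWidth` of `…SymmetricCircuitCountingWidth`
(`theorem AndersonDawar2016_supports_countingWidth_holds`), with the explicit constant `c = 2` and
for every `n` (not only eventually): if `C = (C_n)` is a family of `Sym(Fin n)`-symmetric threshold
circuits on `n × n` adjacency matrices deciding a class `𝒞` of graphs and every gate of `C_n` has
a support of size `≤ k(n)`, then `𝒞` is `≡^{C^{2k(n)+2}}`-invariant on `n`-vertex graphs.

## Sources

* M. Anderson, A. Dawar, *On symmetric circuits and fixed-point logics*, Theory Comput. Syst. 60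
  (2017) 521–551 [AndersonDawar2016]; read in the arXiv text 1401.1125, §4.3 ("we show that how a
  gate `g` evaluates in `C_n` with respect to a structure `𝔸` depends only on how the universe `U`
  of the structure is mapped to the canonical support of `g`"): **Claim 27** (for bijections
  `γ₁, γ₂ : U → [n]` whose inverses agree on `sp(g)`, `γ₁ ∈ Γ(g) ⇔ γ₂ ∈ Γ(g)` and the numbers of
  true children agree — the permutation `π = γ₁γ₂⁻¹` fixes `sp(g)` pointwise, hence is extended by
  an automorphism fixing `g`, which permutes the children of `g`) and **Claim 28** (the counting
  identity `|{h ∈ H : γ ∈ Γ(h)}| · |{δ : δ ∼ α}| = Σ_h Σ_{β ∈ A_h} [β ∈ EV_h] · |{δ : δ ∼ α ∧ δ ∼ β}|`,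
  obtained by averaging over all bijections `δ` consistent with `α = γ⁻¹|sp(g)`), followed in §4.4
  by the translation into fixed-point logic with counting using `O(k)` variables.
* A. Dawar, G. Wilsenach, *Symmetric arithmetic circuits*, Theory of Computing 21 (14) (2025),
  doi:10.4086/toc.2025.v021a014 [DawarWilsenach2025], §6 p. 17: "the proof of [2, Theorem 6]
  establishes this by showing that a circuit of support size `k` translates into a formula with
  `O(k)` variables. Thus, if a class of graphs `𝒞` is decidable by a family of symmetric circuits
  `(C_n)_{n∈ℕ}` with supports of size at most `k(n)` then `𝒞` has counting width `O(k)`."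
* Hella's bijective pebble game as printed in M. Grohe, M. Otto, *Pebble games and linear
  equations*, J. Symb. Log. 80 (2015), §2 [GroheOtto2015] — the tree's DEFINITION of `≡^{C^k}`
  (`CkEquiv`, `BijPebbleStrategy` in `…CkEquiv`).

## Proof architecture (follows Anderson–Dawar §4.3; the last step is game-theoretic)

Fix `n`, the circuit `C = C_n` and supports `S j` (`|S j| ≤ k`). For a permutation `β` of `Fin n`
(the `γ⁻¹` of Anderson–Dawar) let `relabInput G β (p, q) = [G.Adj (β p) (β q)]` be the adjacency
matrix of `G` relabelled along `β`, and `wireValue C G β w` the value of wire `w` of `C` on it.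
* `wireValue_relabelWire`: an automorphism `σ` extending `ρ × ρ` transports values,
  `val_β(σ w) = val_{βρ}(w)` (the tree's `Circuit.IsInducedAut.getD_transcript_eq`).
* `wireValue_eq_of_agree` = Claim 27(i): `val_β(w)` depends only on `β|supp(w)`.
* `numOnes_wireValue_mul` = Claim 27(ii) and `card_stab_mul_numOnes` = Claim 28 in averaged
  form: `|Stab(u)| · #{true children at β} = Σ_i #{ρ ∈ Stab(u) : child i true at βρ}`, `u = S j`.
* `card_filter_stab_wireValue`: grouping `ρ ∈ Stab(u)` by `βρ` restricted to `supp(w) ∖ u`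
  (enumerated by `d : Fin t → Fin n`), each class is a coset of `Stab(u ∪ supp w)`
  (`card_filter_agree`, `filter_stab_comp_eq`), so
  `#{ρ ∈ Stab(u) : w true at βρ} = |Stab(u ∪ supp w)| · #{a : Fin t → Fin n | Q_β(a)}` with
  `Q_β(a) :⇔ ∃ ρ ∈ Stab(u), βρd = a ∧ w true at βρ` (Anderson–Dawar's `A_h ∩ EV_h` count).
* WHERE WE DEVIATE: Anderson–Dawar now write `EV_g` as a formula of counting logic with `O(k)`
  variables and conclude by Hella's theorem. The tree defines `≡^{C^k}` directly by Hella's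
  bijective `k`-pebble game, so the formula is replaced by the standard counting lemma for that
  game, `BijPebbleStrategy.sum_indicator_eq`: from a winning position `p` with `|p| + t ≤ m`,
  properties of `t`-tuples that agree whenever `p ∪ {(a i, b i)}` is winning have equally many
  solutions on both sides (induction on `t`, Duplicator's bijections reindexing the outer sum).
  With `u = S j` pebbled (`≤ k` pairs) and `t = |supp(w) ∖ u| ≤ k + 2` fresh pebbles this needs
  `m = 2k + 2` pebble pairs; `wireValue_transfer` moves `Q` across a winning position (a partial
  bijection; `exists_perm_stab_apply` extends the partial injection on the other side), and
  `wireValue_eq_of_pos_mem` is the induction over the gates in program order.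
* Output: every automorphism fixes the output wire, so the output gate is supported by `∅` (we use
  supports emptied there, `∅` being a winning position); an output INPUT wire `x_{pq}` is fixed by
  `Sym(Fin n)` only if `p = q`, where both adjacency matrices read `false`.
Rigidity and simple wiring (hypotheses of the fact) are not used: only the existence of
automorphisms matters for invariance.
-/

namespace Literature.ModelTheory.FiniteModelTheory

open Finset
open Literature.Computability.Complexity

/-! ## A counting lemma for the bijective pebble game -/

section GameCount

variable {α β : Type*} [Fintype α] [Fintype β]

/-- Splitting a sum over `(t+1)`-tuples according to the first coordinate (`Fin.consEquiv`).
[folklore] -/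
theorem sum_tuple_succ {M : Type*} [AddCommMonoid M] (t : ℕ) (F : (Fin (t + 1) → α) → M) :
    ∑ a, F a = ∑ x : α, ∑ a' : Fin t → α, F (Fin.cons x a') := by
  rw [← Fintype.sum_prod_type']
  exact Fintype.sum_equiv (Fin.consEquiv fun _ => α).symm _ _ fun a => by
    simp [Fin.consEquiv]

/-- **Counting lemma for Hella's bijective pebble game.** Let `𝔖` be a winning strategy for
Duplicator in the bijective `m`-pebble game on `G`, `H`, let `p ∈ 𝔖` be a winning position with
`|p| + t ≤ m`, and let `Q_A`, `Q_B` be properties of `t`-tuples over `V(G)`, `V(H)` which agree on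
`a`, `b` whenever `p ∪ {(a i, b i) : i < t}` is a winning position. Then `Q_A` and `Q_B` have the
same number of solutions. (Induction on `t`: Duplicator's bijection `f` at `p` reindexes the sum
over the first coordinate, and `p ∪ {(x, f x)}` is again winning with `t - 1` pebbles to spare.
This is the game-theoretic content of "a formula with `t` further counting quantifiers does not
distinguish the two sides", Grohe–Otto 2015, §2 / Hella 1996.) [folklore] -/
theorem BijPebbleStrategy.sum_indicator_eq {m : ℕ} {G : SimpleGraph α} {H : SimpleGraph β}
    (𝔖 : BijPebbleStrategy m G H) :
    ∀ (t : ℕ) (p : Set (α × β)), p ∈ 𝔖.carrier → p.ncard + t ≤ m →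
      ∀ (QA : (Fin t → α) → Prop) (QB : (Fin t → β) → Prop) [DecidablePred QA]
        [DecidablePred QB],
      (∀ (a : Fin t → α) (b : Fin t → β),
          p ∪ Set.range (fun i => (a i, b i)) ∈ 𝔖.carrier → (QA a ↔ QB b)) →
      (∑ a : Fin t → α, if QA a then 1 else 0 : ℕ) = ∑ b : Fin t → β, if QB b then 1 else 0
  | 0, p, hp, _, QA, QB, _, _, h => by
    have h0 : QA default ↔ QB default :=
      h default default (by rwa [Set.range_eq_empty, Set.union_empty])
    rw [Fintype.sum_unique, Fintype.sum_unique]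
    by_cases hB : QB default
    · rw [if_pos hB, if_pos (h0.2 hB)]
    · rw [if_neg hB, if_neg (mt h0.1 hB)]
  | t + 1, p, hp, hpt, QA, QB, _, _, h => by
    obtain ⟨f, hf⟩ := 𝔖.forth hp (by omega)
    rw [sum_tuple_succ t (fun a => if QA a then 1 else 0),
      sum_tuple_succ t (fun b => if QB b then 1 else 0)]
    refine Eq.trans (Finset.sum_congr rfl fun x _ => ?_)
      (Fintype.sum_equiv f (fun x => ∑ b' : Fin t → β, if QB (Fin.cons (f x) b') then 1 else 0)
        (fun y => ∑ b' : Fin t → β, if QB (Fin.cons y b') then 1 else 0) fun _ => rfl)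
    refine BijPebbleStrategy.sum_indicator_eq 𝔖 t (insert (x, f x) p) (hf x)
      (by have := Set.ncard_insert_le (x, f x) p; omega)
      (fun a' => QA (Fin.cons x a')) (fun b' => QB (Fin.cons (f x) b')) fun a' b' hab => h _ _ ?_
    refine 𝔖.mem_of_subset hab ?_
    rintro z (hz | ⟨i, rfl⟩)
    · exact Or.inl (Set.mem_insert_of_mem _ hz)
    · refine Fin.cases ?_ (fun i => ?_) i
      · exact Or.inl (by simp)
      · exact Or.inr ⟨i, by simp⟩

end GameCount

/-! ## Values of the wires of a matrix circuit on a relabelled adjacency matrix -/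

section Circuits

variable {n : ℕ}

/-- The adjacency matrix of `G` relabelled along the permutation `β` of `Fin n`:
`relabInput G β (p, q) = [G.Adj (β p) (β q)]`. In Anderson–Dawar's notation this is the encoding
`γ𝔸` of the structure `𝔸 = G` by the bijection `γ = β⁻¹ : U → [n]` (2017, §4.3).
[cite: AndersonDawar2016, §4.3] -/
def relabInput (G : SimpleGraph (Fin n)) [DecidableRel G.Adj] (β : Equiv.Perm (Fin n)) :
    Fin n × Fin n → Bool :=
  fun q => adjInput G (β q.1, β q.2)

/-- The value of the wire `w` (an input `x_{pq}` or a gate) of the circuit `C` evaluated on the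
relabelled adjacency matrix `relabInput G β` — Anderson–Dawar's `C_n[γ𝔸](g)` with `γ = β⁻¹`.
[cite: AndersonDawar2016, §4.3] -/
def wireValue (C : Circuit (Fin n × Fin n)) (G : SimpleGraph (Fin n)) [DecidableRel G.Adj]
    (β : Equiv.Perm (Fin n)) (w : (Fin n × Fin n) ⊕ ℕ) : Bool :=
  wireVal (relabInput G β) (transcript (relabInput G β) [] C.gates) w

/-- The pointwise stabiliser `Stab(u)` of a set `u ⊆ [n]` in `Sym(Fin n)`, as a `Finset` of
permutations (Anderson–Dawar 2017, §2.2). [cite: AndersonDawar2016, §2.2] -/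
def stabFinset (u : Finset (Fin n)) : Finset (Equiv.Perm (Fin n)) :=
  univ.filter fun ρ => ∀ s ∈ u, ρ s = s

/-- The support of a wire, given supports `S j` of the gates: an input wire `x_{pq}` is supported
by `{p, q}` (Anderson–Dawar 2017, §4.3: the support of a relational gate is "the set of elements in
the tuple `Λ_R(g)`"), the gate `j` by `S j`; out-of-range back-references (which do not occur in a
well-formed circuit) get `∅`. [cite: AndersonDawar2016, §4.3] -/
def wireSupp (C : Circuit (Fin n × Fin n)) (S : Fin C.gates.length → Finset (Fin n)) :
    (Fin n × Fin n) ⊕ ℕ → Finset (Fin n)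
  | .inl q => {q.1, q.2}
  | .inr m => if h : m < C.gates.length then S ⟨m, h⟩ else ∅

variable (C : Circuit (Fin n × Fin n)) (G : SimpleGraph (Fin n)) [DecidableRel G.Adj]

/-- Relabelling along a product: `relabInput G (β * ρ) = relabInput G β ∘ (ρ × ρ)`. [folklore] -/
theorem relabInput_mul (β ρ : Equiv.Perm (Fin n)) :
    (fun q : Fin n × Fin n => relabInput G β (ρ q.1, ρ q.2)) = relabInput G (β * ρ) := by
  funext q
  simp [relabInput, Equiv.Perm.mul_apply]

/-- Relabelling along the identity gives the adjacency input itself. [folklore] -/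
theorem relabInput_one : relabInput G 1 = adjInput G := by
  funext q
  simp [relabInput]

/-- The value of an input wire is the relabelled matrix entry. [folklore] -/
theorem wireValue_inl (β : Equiv.Perm (Fin n)) (q : Fin n × Fin n) :
    wireValue C G β (Sum.inl q) = decide (G.Adj (β q.1) (β q.2)) := rfl

/-- The value of gate `j` is its gate function applied to the values of its argument wires (the
gate equations of the true transcript, `getD_transcript_eq_gateValue`). [folklore] -/
theorem wireValue_inr_of_lt (β : Equiv.Perm (Fin n)) {j : ℕ} (hj : j < C.gates.length) :
    wireValue C G β (Sum.inr j) =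
      (C.gates[j]).op (fun a => wireValue C G β ((C.gates[j]).args a)) := by
  unfold wireValue
  exact getD_transcript_eq_gateValue C (relabInput G β) j hj

/-- Out-of-range back-references read `false`. [folklore] -/
theorem wireValue_inr_of_le (β : Equiv.Perm (Fin n)) {j : ℕ} (hj : C.gates.length ≤ j) :
    wireValue C G β (Sum.inr j) = false := by
  unfold wireValue
  show (transcript (relabInput G β) [] C.gates).getD j false = false
  refine List.getD_eq_default _ _ ?_
  rw [length_transcript, List.length_nil, zero_add]
  exact hj

/-- The circuit's output on the adjacency matrix of `G` is the value of the output wire at the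
identity relabelling. [folklore] -/
theorem eval_adjInput_eq_wireValue : C.eval (adjInput G) = wireValue C G 1 C.output := by
  rw [eval_eq_wireVal, wireValue, relabInput_one]

/-- **Automorphisms transport wire values** (Anderson–Dawar 2017, §2.2/§4.3: for an automorphism
`π` of `C_n`, `C_n[γ𝔸](g) = C_n[(πγ)𝔸](πg)`): if `σ` is an automorphism of `C` extending `ρ × ρ`
and all gates are symmetric, the value of the relabelled wire `σ w` at `β` is the value of `w` at
`β * ρ`. The tree's `Circuit.IsInducedAut.getD_transcript_eq`. [cite: AndersonDawar2016, §4.3 Claim 27 (proof)] -/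
theorem wireValue_relabelWire {C : Circuit (Fin n × Fin n)} (hsym : ∀ g ∈ C.gates, g.fn.IsSymmetric)
    {ρ : Equiv.Perm (Fin n)} {σ : Equiv.Perm (Fin C.gates.length)}
    (hσ : C.IsInducedAut (fun q : Fin n × Fin n => (ρ q.1, ρ q.2)) σ) (β : Equiv.Perm (Fin n))
    (w : (Fin n × Fin n) ⊕ ℕ) :
    wireValue C G β (Circuit.relabelWire (fun q : Fin n × Fin n => (ρ q.1, ρ q.2)) σ w) =
      wireValue C G (β * ρ) w := by
  cases w with
  | inl q =>
    rw [Circuit.relabelWire_inl, wireValue_inl, wireValue_inl]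
    simp [Equiv.Perm.mul_apply]
  | inr m =>
    by_cases hm : m < C.gates.length
    · rw [Circuit.relabelWire_inr, Circuit.relabelGate_of_lt σ hm]
      unfold wireValue
      show (transcript (relabInput G β) [] C.gates).getD (σ ⟨m, hm⟩) false =
        (transcript (relabInput G (β * ρ)) [] C.gates).getD m false
      rw [hσ.getD_transcript_eq hsym (relabInput G β) m hm, relabInput_mul]
    · rw [Circuit.relabelWire_inr, Circuit.relabelGate_of_le σ (Nat.not_lt.1 hm),
        wireValue_inr_of_le C G _ (Nat.not_lt.1 hm), wireValue_inr_of_le C G _ (Nat.not_lt.1 hm)]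

/-- **Anderson–Dawar, Claim 27(i): the value of a wire depends only on the relabelling restricted
to its support.** If `β` and `β'` agree on `supp(w)` then `w` takes the same value at `β` and at
`β'`: `ρ = β⁻¹β'` fixes the support pointwise, so some automorphism extending `ρ × ρ` fixes the
gate, and automorphisms transport values. [cite: AndersonDawar2016, §4.3 Claim 27(i)] -/
theorem wireValue_eq_of_agree {C : Circuit (Fin n × Fin n)} (hsym : ∀ g ∈ C.gates, g.fn.IsSymmetric)
    {S : Fin C.gates.length → Finset (Fin n)}
    (hS : ∀ j, C.Supports Set.univ (↑(S j) : Set (Fin n)) j) {β β' : Equiv.Perm (Fin n)}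
    (w : (Fin n × Fin n) ⊕ ℕ) (h : ∀ s ∈ wireSupp C S w, β s = β' s) :
    wireValue C G β w = wireValue C G β' w := by
  cases w with
  | inl q =>
    have h1 : β q.1 = β' q.1 := h q.1 (by simp [wireSupp])
    have h2 : β q.2 = β' q.2 := h q.2 (by simp [wireSupp])
    rw [wireValue_inl, wireValue_inl, h1, h2]
  | inr m =>
    by_cases hm : m < C.gates.length
    · set ρ : Equiv.Perm (Fin n) := β⁻¹ * β' with hρ_def
      have hfix : ∀ s ∈ (↑(S ⟨m, hm⟩) : Set (Fin n)), ρ s = s := by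
        intro s hs
        have hs' : s ∈ wireSupp C S (Sum.inr m) := by
          simp only [wireSupp, dif_pos hm]
          exact hs
        rw [hρ_def, Equiv.Perm.mul_apply, ← h s hs']
        exact β.symm_apply_apply s
      obtain ⟨-, σ, hσ, hσm⟩ := hS ⟨m, hm⟩ ρ (Set.mem_univ _) hfix
      have key := wireValue_relabelWire G hsym hσ β (Sum.inr m)
      rw [Circuit.relabelWire_inr, Circuit.relabelGate_of_lt σ hm, hσm] at key
      have hβ' : β * ρ = β' := by rw [hρ_def, mul_inv_cancel_left]
      rw [hβ'] at key
      exact key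
    · rw [wireValue_inr_of_le C G _ (Nat.not_lt.1 hm), wireValue_inr_of_le C G _ (Nat.not_lt.1 hm)]

/-- **Anderson–Dawar, Claim 27(ii): a permutation fixing the support of a gate preserves the
number of its true children.** If `ρ` fixes `u ⊇`-a support of gate `j` pointwise, the number of
argument wires of `j` that are true at `β` equals the number true at `β * ρ` (an automorphism
extending `ρ × ρ` fixes `j`, hence permutes its argument list, and transports values).
[cite: AndersonDawar2016, §4.3 Claim 27(ii)] -/
theorem numOnes_wireValue_mul {C : Circuit (Fin n × Fin n)} (hsym : ∀ g ∈ C.gates, g.fn.IsSymmetric)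
    {u : Finset (Fin n)} {j : ℕ} (hj : j < C.gates.length)
    (hS : C.Supports Set.univ (↑u : Set (Fin n)) ⟨j, hj⟩) (β ρ : Equiv.Perm (Fin n))
    (hρ : ∀ s ∈ u, ρ s = s) :
    GateFn.numOnes (fun i => wireValue C G β ((C.gates[j]).args i)) =
      GateFn.numOnes (fun i => wireValue C G (β * ρ) ((C.gates[j]).args i)) := by
  obtain ⟨-, σ, hσ, hσj⟩ := hS ρ (Set.mem_univ _) (fun s hs => hρ s hs)
  -- `σ` fixes gate `j`, so the gate read through `σ` is gate `j` itself
  have hidx : C.gates[σ ⟨j, hj⟩] = C.gates[j] := by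
    have h := congrArg (fun i : Fin C.gates.length => C.gates[i]) hσj
    simpa using h
  have h2 := (hσ.2 ⟨j, hj⟩).2
  rw [hidx] at h2
  simp only [Fin.getElem_fin] at h2
  exact Circuit.numOnes_eq_of_perm_map h2 fun i => wireValue_relabelWire G hsym hσ β _

/-- **Anderson–Dawar, Claim 28 (averaged form).** Summing Claim 27(ii) over the pointwise
stabiliser `Stab(u)` of a support `u` of gate `j` and exchanging the sums:
`|Stab(u)| · #{true children of j at β} = Σ_i #{ρ ∈ Stab(u) : child i true at βρ}` — the
first line of the displayed computation in the proof of Claim 28 (with `δ⁻¹ = βρ` ranging over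
the bijections consistent with `β|u`). [cite: AndersonDawar2016, §4.3 Claim 28] -/
theorem card_stab_mul_numOnes {C : Circuit (Fin n × Fin n)}
    (hsym : ∀ g ∈ C.gates, g.fn.IsSymmetric) {u : Finset (Fin n)} {j : ℕ} (hj : j < C.gates.length)
    (hS : C.Supports Set.univ (↑u : Set (Fin n)) ⟨j, hj⟩) (β : Equiv.Perm (Fin n)) :
    (stabFinset u).card * GateFn.numOnes (fun i => wireValue C G β ((C.gates[j]).args i)) =
      ∑ i : Fin (C.gates[j]).arity,
        ((stabFinset u).filter fun ρ => wireValue C G (β * ρ) ((C.gates[j]).args i) = true).card := by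
  calc (stabFinset u).card * GateFn.numOnes (fun i => wireValue C G β ((C.gates[j]).args i))
      = ∑ _ρ ∈ stabFinset u, GateFn.numOnes (fun i => wireValue C G β ((C.gates[j]).args i)) := by
        rw [Finset.sum_const, smul_eq_mul]
    _ = ∑ ρ ∈ stabFinset u,
          GateFn.numOnes (fun i => wireValue C G (β * ρ) ((C.gates[j]).args i)) :=
        Finset.sum_congr rfl fun ρ hρ => numOnes_wireValue_mul G hsym hj hS β ρ (by
          simp only [stabFinset, Finset.mem_filter, Finset.mem_univ, true_and] at hρ
          exact hρ)
    _ = ∑ ρ ∈ stabFinset u, ∑ i : Fin (C.gates[j]).arity,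
          (if wireValue C G (β * ρ) ((C.gates[j]).args i) = true then 1 else 0) := by
        simp only [GateFn.numOnes, Finset.card_filter]
    _ = ∑ i : Fin (C.gates[j]).arity, ∑ ρ ∈ stabFinset u,
          (if wireValue C G (β * ρ) ((C.gates[j]).args i) = true then 1 else 0) :=
        Finset.sum_comm
    _ = _ := Finset.sum_congr rfl fun i _ => (Finset.card_filter _ _).symm

/-- A coset count in `Sym(Fin n)`: the permutations agreeing with `ρ₀` on `T` are as many as the
pointwise stabiliser of `T` (they form the coset `ρ₀ · Stab(T)`). [folklore] -/
theorem card_filter_agree (T : Finset (Fin n)) (ρ₀ : Equiv.Perm (Fin n)) :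
    (univ.filter fun ρ : Equiv.Perm (Fin n) => ∀ s ∈ T, ρ s = ρ₀ s).card = (stabFinset T).card := by
  refine (Finset.card_bij (fun τ _ => ρ₀ * τ) (fun τ hτ => ?_) (fun τ₁ _ τ₂ _ h => ?_)
    (fun ρ hρ => ?_)).symm
  · simp only [stabFinset, Finset.mem_filter, Finset.mem_univ, true_and] at hτ ⊢
    intro s hs
    rw [Equiv.Perm.mul_apply, hτ s hs]
  · exact mul_left_cancel h
  · simp only [Finset.mem_filter, Finset.mem_univ, true_and] at hρ
    refine ⟨ρ₀⁻¹ * ρ, ?_, mul_inv_cancel_left ρ₀ ρ⟩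
    simp only [stabFinset, Finset.mem_filter, Finset.mem_univ, true_and]
    intro s hs
    rw [Equiv.Perm.mul_apply, hρ s hs]
    exact ρ₀.symm_apply_apply s

/-- The class of `ρ ∈ Stab(u)` with prescribed values `β (ρ (d i)) = a i` on the fresh support
elements `d i` is — when non-empty, witnessed by `ρ₀` — the set of permutations agreeing with `ρ₀`
on `u ∪ {d i}` (Anderson–Dawar's `{δ : δ ∼ α ∧ δ ∼ β}`). [cite: AndersonDawar2016, §4.3 Claim 28 (proof)] -/
theorem filter_stab_comp_eq {t : ℕ} (u : Finset (Fin n)) (d : Fin t → Fin n)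
    (β ρ₀ : Equiv.Perm (Fin n)) (hρ₀ : ρ₀ ∈ stabFinset u) (a : Fin t → Fin n)
    (ha : (fun i => β (ρ₀ (d i))) = a) :
    (stabFinset u).filter (fun ρ => (fun i => β (ρ (d i))) = a) =
      univ.filter fun ρ : Equiv.Perm (Fin n) => ∀ s ∈ u ∪ univ.image d, ρ s = ρ₀ s := by
  ext ρ
  simp only [stabFinset, Finset.mem_filter, Finset.mem_univ, true_and, Finset.mem_union,
    Finset.mem_image] at hρ₀ ⊢
  constructor
  · rintro ⟨hρ, hρa⟩ s hs
    rcases hs with hs | ⟨i, rfl⟩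
    · rw [hρ s hs, hρ₀ s hs]
    · have h1 := congrFun hρa i
      have h0 := congrFun ha i
      exact β.injective (h1.trans h0.symm)
  · intro h
    refine ⟨fun s hs => (h s (Or.inl hs)).trans (hρ₀ s hs), funext fun i => ?_⟩
    rw [h (d i) (Or.inr ⟨i, rfl⟩)]
    exact congrFun ha i

/-- **The count of Claim 28, evaluated.** For a wire `w` whose support is covered by `u` and the
fresh elements `d i`, grouping `ρ ∈ Stab(u)` by the values `β (ρ (d i))`:
`#{ρ ∈ Stab(u) : w true at βρ} = |Stab(u ∪ {d i})| · #{a | ∃ ρ ∈ Stab(u), βρd = a ∧ w true at βρ}`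
(each non-empty class is a coset of `Stab(u ∪ {d i})` on which the value of `w` is constant by
Claim 27(i); Anderson–Dawar: "`|{δ : δ ∼ α ∧ δ ∼ β}| / |{δ : δ ∼ α}| = 1 / |A_h|`").
[cite: AndersonDawar2016, §4.3 Claim 28] -/
theorem card_filter_stab_wireValue {C : Circuit (Fin n × Fin n)}
    (hsym : ∀ g ∈ C.gates, g.fn.IsSymmetric) {S : Fin C.gates.length → Finset (Fin n)}
    (hS : ∀ j, C.Supports Set.univ (↑(S j) : Set (Fin n)) j) (u : Finset (Fin n))
    (w : (Fin n × Fin n) ⊕ ℕ) {t : ℕ} (d : Fin t → Fin n)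
    (hcov : ∀ s ∈ wireSupp C S w, s ∉ u → ∃ i, d i = s) (β : Equiv.Perm (Fin n)) :
    ((stabFinset u).filter fun ρ => wireValue C G (β * ρ) w = true).card =
      (stabFinset (u ∪ univ.image d)).card *
        ∑ a : Fin t → Fin n,
          (if (∃ ρ ∈ stabFinset u, (fun i => β (ρ (d i))) = a ∧ wireValue C G (β * ρ) w = true)
            then 1 else 0) := by
  rw [Finset.card_filter, Finset.mul_sum]
  have step : ∀ ρ ∈ stabFinset u, (if wireValue C G (β * ρ) w = true then 1 else 0 : ℕ) =
      ∑ a : Fin t → Fin n, (if (fun i => β (ρ (d i))) = a then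
        (if wireValue C G (β * ρ) w = true then 1 else 0 : ℕ) else 0) := by
    intro ρ _
    rw [Finset.sum_ite_eq, if_pos (Finset.mem_univ _)]
  rw [Finset.sum_congr rfl step, Finset.sum_comm]
  refine Finset.sum_congr rfl fun a _ => ?_
  by_cases hQ : ∃ ρ ∈ stabFinset u, (fun i => β (ρ (d i))) = a ∧ wireValue C G (β * ρ) w = true
  · rw [if_pos hQ, mul_one]
    obtain ⟨ρ₀, hρ₀, ha₀, hw₀⟩ := hQ
    have hconst : ∀ ρ ∈ stabFinset u, (fun i => β (ρ (d i))) = a →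
        wireValue C G (β * ρ) w = true := by
      intro ρ hρ ha
      rw [← hw₀]
      refine wireValue_eq_of_agree G hsym hS w fun s hs => ?_
      by_cases hsu : s ∈ u
      · simp only [stabFinset, Finset.mem_filter, Finset.mem_univ, true_and] at hρ hρ₀
        rw [Equiv.Perm.mul_apply, Equiv.Perm.mul_apply, hρ s hsu, hρ₀ s hsu]
      · obtain ⟨i, rfl⟩ := hcov s hs hsu
        rw [Equiv.Perm.mul_apply, Equiv.Perm.mul_apply]
        exact (congrFun ha i).trans (congrFun ha₀ i).symm
    calc ∑ ρ ∈ stabFinset u, (if (fun i => β (ρ (d i))) = a then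
            (if wireValue C G (β * ρ) w = true then 1 else 0 : ℕ) else 0)
        = ∑ ρ ∈ stabFinset u, (if (fun i => β (ρ (d i))) = a then 1 else 0 : ℕ) := by
          refine Finset.sum_congr rfl fun ρ hρ => ?_
          by_cases ha : (fun i => β (ρ (d i))) = a
          · rw [if_pos ha, if_pos ha, if_pos (hconst ρ hρ ha)]
          · rw [if_neg ha, if_neg ha]
      _ = ((stabFinset u).filter fun ρ => (fun i => β (ρ (d i))) = a).card :=
          (Finset.card_filter _ _).symm
      _ = (stabFinset (u ∪ univ.image d)).card := by
          rw [filter_stab_comp_eq u d β ρ₀ hρ₀ a ha₀, card_filter_agree]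
  · rw [if_neg hQ, mul_zero]
    refine Finset.sum_eq_zero fun ρ hρ => ?_
    by_cases ha : (fun i => β (ρ (d i))) = a
    · rw [if_pos ha]
      by_cases hw : wireValue C G (β * ρ) w = true
      · exact absurd ⟨ρ, hρ, ha, hw⟩ hQ
      · rw [if_neg hw]
    · rw [if_neg ha]

/-- An injective partial map on a finite subset of `Fin n` extends to a permutation of `Fin n`
(`Finset.exists_equiv_extend_of_card_eq`). [folklore] -/
theorem exists_perm_extend (T : Finset (Fin n)) (f : Fin n → Fin n) (hf : Set.InjOn f ↑T) :
    ∃ ρ : Equiv.Perm (Fin n), ∀ s ∈ T, ρ s = f s := by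
  obtain ⟨g, hg⟩ := Finset.exists_equiv_extend_of_card_eq (t := (univ : Finset (Fin n)))
    (Finset.card_univ (α := Fin n)).symm (s := T) (f := f) (Finset.subset_univ _) hf
  exact ⟨g.trans (Equiv.subtypeUnivEquiv Finset.mem_univ), fun s hs => by
    rw [Equiv.trans_apply]
    exact hg s hs⟩

/-- A permutation fixing `u` pointwise with prescribed (injective, `u`-avoiding) values `c i` on
fresh points `d i ∉ u` exists. [folklore] -/
theorem exists_perm_stab_apply {t : ℕ} (u : Finset (Fin n)) (d : Fin t → Fin n)
    (hd : Function.Injective d) (hdu : ∀ i, d i ∉ u) (c : Fin t → Fin n)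
    (hc : Function.Injective c) (hcu : ∀ i, c i ∉ u) :
    ∃ ρ : Equiv.Perm (Fin n), (∀ s ∈ u, ρ s = s) ∧ ∀ i, ρ (d i) = c i := by
  classical
  let f : Fin n → Fin n := Function.extend d c id
  have hfd : ∀ i, f (d i) = c i := fun i => hd.extend_apply c id i
  have hfu : ∀ s ∈ u, f s = s := fun s hs => by
    have hne : ¬ ∃ i, d i = s := fun ⟨i, hi⟩ => hdu i (hi ▸ hs)
    exact Function.extend_apply' c id s hne
  obtain ⟨ρ, hρ⟩ := exists_perm_extend (u ∪ univ.image d) f (by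
    intro x hx y hy hxy
    simp only [Finset.coe_union, Finset.coe_image, Finset.coe_univ, Set.image_univ, Set.mem_union,
      Finset.mem_coe, Set.mem_range] at hx hy
    rcases hx with hx | ⟨i, rfl⟩ <;> rcases hy with hy | ⟨i', rfl⟩
    · rwa [hfu x hx, hfu y hy] at hxy
    · rw [hfu x hx, hfd] at hxy
      exact absurd (hxy ▸ hx) (hcu i')
    · rw [hfd, hfu y hy] at hxy
      exact absurd (hxy ▸ hy) (hcu i)
    · rw [hfd, hfd] at hxy
      rw [hc hxy])
  refine ⟨ρ, fun s hs => (hρ s (Finset.mem_union_left _ hs)).trans (hfu s hs), fun i => ?_⟩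
  exact (hρ (d i) (Finset.mem_union_right _
    (Finset.mem_image_of_mem d (Finset.mem_univ i)))).trans (hfd i)

/-- **Transfer across a winning position.** The count predicate
`Q_β(a) :⇔ ∃ ρ ∈ Stab(u), βρd = a ∧ w true at βρ` passes from the `G`-side `(β_A, a)` to the
`H`-side `(β_B, b)` whenever the pebble pairs `(β_A s, β_B s)` (`s ∈ u`) and `(a i, b i)` form a
partial bijection along which `w` takes equal values (the latter is the induction hypothesis of
the main induction). The partial bijection makes `β_B⁻¹ b` injective and `u`-avoiding, so it is
realised by some `ρ_B ∈ Stab(u)` (`exists_perm_stab_apply`). [folklore] -/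
theorem wireValue_transfer {C : Circuit (Fin n × Fin n)} {G H : SimpleGraph (Fin n)}
    [DecidableRel G.Adj] [DecidableRel H.Adj] {t : ℕ} (u : Finset (Fin n)) (d : Fin t → Fin n)
    (hd : Function.Injective d) (hdu : ∀ i, d i ∉ u) (w : (Fin n × Fin n) ⊕ ℕ)
    (βA βB : Equiv.Perm (Fin n)) (a b : Fin t → Fin n)
    (hab : ∀ i i', a i = a i' ↔ b i = b i') (habu : ∀ i, ∀ s ∈ u, (a i = βA s ↔ b i = βB s))
    (hW : ∀ ρA ρB : Equiv.Perm (Fin n), (∀ s ∈ u, ρA s = s) → (∀ s ∈ u, ρB s = s) →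
      (∀ i, βA (ρA (d i)) = a i) → (∀ i, βB (ρB (d i)) = b i) →
      wireValue C G (βA * ρA) w = wireValue C H (βB * ρB) w)
    (hQ : ∃ ρ ∈ stabFinset u, (fun i => βA (ρ (d i))) = a ∧ wireValue C G (βA * ρ) w = true) :
    ∃ ρ ∈ stabFinset u, (fun i => βB (ρ (d i))) = b ∧ wireValue C H (βB * ρ) w = true := by
  obtain ⟨ρA, hρA, ha, hwA⟩ := hQ
  simp only [stabFinset, Finset.mem_filter, Finset.mem_univ, true_and] at hρA
  have ha' : ∀ i, βA (ρA (d i)) = a i := fun i => congrFun ha i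
  have hb_inj : Function.Injective b := fun i i' h => by
    have h1 : a i = a i' := (hab i i').2 h
    rw [← ha' i, ← ha' i'] at h1
    exact hd (ρA.injective (βA.injective h1))
  have hbu : ∀ i, βB.symm (b i) ∉ u := fun i hmem => by
    have h1 : b i = βB (βB.symm (b i)) := (βB.apply_symm_apply (b i)).symm
    have h2 : a i = βA (βB.symm (b i)) := (habu i _ hmem).2 h1
    rw [← ha' i] at h2
    have h3 : ρA (d i) = βB.symm (b i) := βA.injective h2
    have h4 : d i = βB.symm (b i) := ρA.injective (h3.trans (hρA _ hmem).symm)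
    exact hdu i (h4 ▸ hmem)
  obtain ⟨ρB, hρB, hρBd⟩ := exists_perm_stab_apply u d hd hdu (fun i => βB.symm (b i))
    (fun i i' h => hb_inj (βB.symm.injective h)) hbu
  have hb' : ∀ i, βB (ρB (d i)) = b i := fun i => by
    rw [hρBd i]
    exact βB.apply_symm_apply (b i)
  refine ⟨ρB, ?_, funext hb', ?_⟩
  · simp only [stabFinset, Finset.mem_filter, Finset.mem_univ, true_and]
    exact hρB
  · rw [← hW ρA ρB hρA hρB ha' hb', hwA]

/-- Supports have at most `k + 2` elements when the gate supports have at most `k` (input wires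
are supported by two points). [folklore] -/
theorem card_wireSupp_le {C : Circuit (Fin n × Fin n)} {S : Fin C.gates.length → Finset (Fin n)}
    {k : ℕ} (hk : ∀ j, (S j).card ≤ k) (w : (Fin n × Fin n) ⊕ ℕ) :
    (wireSupp C S w).card ≤ k + 2 := by
  cases w with
  | inl q => exact (Finset.card_le_two (a := q.1) (b := q.2)).trans (by omega)
  | inr m =>
    simp only [wireSupp]
    split_ifs with h
    · exact (hk _).trans (by omega)
    · simp

/-- **The induction over the circuit** (Anderson–Dawar's recursive construction of `EV_g`, §4.3,
run against a Duplicator strategy instead of being written as a formula): if Duplicator wins the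
bijective `(2k+2)`-pebble game on `G`, `H` and all gate supports have size `≤ k`, then for every
gate `j` and all relabellings `β_A`, `β_B` such that the pairs `(β_A s, β_B s)`, `s ∈ S j`, form a
winning position, gate `j` takes the same value on `G` relabelled by `β_A` and on `H` relabelled
by `β_B`. Inductive step: by Claim 28 it suffices to compare, for each argument wire `w`, the
counts `#{ρ ∈ Stab(S j) : w true at βρ}`; by `card_filter_stab_wireValue` these are a common
factor times the number of solutions of `Q_{β_A}`, `Q_{β_B}`, which agree by the game counting
lemma (`|S j| ≤ k` pebbles on the board, `|supp w ∖ S j| ≤ k + 2` fresh ones) and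
`wireValue_transfer`. [cite: AndersonDawar2016, §4.3 (Claims 27–28, recursive definition of EV_g)] -/
theorem wireValue_eq_of_pos_mem {C : Circuit (Fin n × Fin n)} {G H : SimpleGraph (Fin n)}
    [DecidableRel G.Adj] [DecidableRel H.Adj] (hsym : ∀ g ∈ C.gates, g.fn.IsSymmetric)
    {S : Fin C.gates.length → Finset (Fin n)}
    (hS : ∀ j, C.Supports Set.univ (↑(S j) : Set (Fin n)) j) {k : ℕ} (hk : ∀ j, (S j).card ≤ k)
    (𝔖 : BijPebbleStrategy (2 * k + 2) G H) :
    ∀ (j : ℕ) (hj : j < C.gates.length) (βA βB : Equiv.Perm (Fin n)),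
      (fun s => (βA s, βB s)) '' (↑(S ⟨j, hj⟩) : Set (Fin n)) ∈ 𝔖.carrier →
      wireValue C G βA (Sum.inr j) = wireValue C H βB (Sum.inr j) := by
  intro j
  induction j using Nat.strong_induction_on with
  | _ j ih =>
  intro hj βA βB hpos
  rw [wireValue_inr_of_lt C G βA hj, wireValue_inr_of_lt C H βB hj]
  refine Gate.op_eq_op_of_fn_eq rfl (hsym (C.gates[j]) (List.getElem_mem hj)) ?_
  -- the induction hypothesis, in wire form, for the argument wires of gate `j`
  have hwire : ∀ (i : Fin (C.gates[j]).arity) (βA' βB' : Equiv.Perm (Fin n)),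
      (fun s => (βA' s, βB' s)) '' (↑(wireSupp C S ((C.gates[j]).args i)) : Set (Fin n))
        ∈ 𝔖.carrier →
      wireValue C G βA' ((C.gates[j]).args i) = wireValue C H βB' ((C.gates[j]).args i) := by
    intro i βA' βB' hpos'
    generalize hw : (C.gates[j]).args i = w at hpos' ⊢
    cases w with
    | inl q =>
      have hiso := 𝔖.isPartialIso_of_mem hpos'
      have h1 : (βA' q.1, βB' q.1) ∈
          (fun s => (βA' s, βB' s)) '' (↑(wireSupp C S (Sum.inl q)) : Set (Fin n)) :=
        ⟨q.1, by simp [wireSupp], rfl⟩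
      have h2 : (βA' q.2, βB' q.2) ∈
          (fun s => (βA' s, βB' s)) '' (↑(wireSupp C S (Sum.inl q)) : Set (Fin n)) :=
        ⟨q.2, by simp [wireSupp], rfl⟩
      have hadj := hiso.adj_iff h1 h2
      rw [wireValue_inl, wireValue_inl]
      exact (decide_eq_decide).2 hadj
    | inr m =>
      have hm : m < j := C.wf j hj i m hw
      have hmlen : m < C.gates.length := hm.trans hj
      refine ih m hm hmlen βA' βB' ?_
      simpa only [wireSupp, dif_pos hmlen] using hpos'
  -- the per-argument counts agree
  have hcount : ∀ i : Fin (C.gates[j]).arity,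
      ((stabFinset (S ⟨j, hj⟩)).filter fun ρ => wireValue C G (βA * ρ) ((C.gates[j]).args i) = true).card =
      ((stabFinset (S ⟨j, hj⟩)).filter fun ρ => wireValue C H (βB * ρ) ((C.gates[j]).args i) = true).card := by
    intro i
    set w := (C.gates[j]).args i with hw_def
    set D : Finset (Fin n) := wireSupp C S w \ S ⟨j, hj⟩ with hD_def
    set d : Fin D.card → Fin n := fun i => D.orderEmbOfFin rfl i with hd_def
    have hd_inj : Function.Injective d := (D.orderEmbOfFin rfl).injective
    have hd_mem : ∀ i, d i ∈ D := fun i => D.orderEmbOfFin_mem rfl i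
    have hdu : ∀ i, d i ∉ S ⟨j, hj⟩ := fun i => (Finset.mem_sdiff.1 (hd_mem i)).2
    have hcov : ∀ s ∈ wireSupp C S w, s ∉ S ⟨j, hj⟩ → ∃ i, d i = s := by
      intro s hs hsu
      have hsD : s ∈ (Set.range (D.orderEmbOfFin rfl) : Set (Fin n)) := by
        rw [Finset.range_orderEmbOfFin]
        exact Finset.mem_coe.2 (Finset.mem_sdiff.2 ⟨hs, hsu⟩)
      obtain ⟨i, hi⟩ := hsD
      exact ⟨i, hi⟩
    rw [card_filter_stab_wireValue G hsym hS (S ⟨j, hj⟩) w d hcov βA,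
      card_filter_stab_wireValue H hsym hS (S ⟨j, hj⟩) w d hcov βB]
    congr 1
    -- the game counting lemma
    have hpt : ((fun s => (βA s, βB s)) '' (↑(S ⟨j, hj⟩) : Set (Fin n))).ncard + D.card ≤ 2 * k + 2 := by
      have h1 : ((fun s => (βA s, βB s)) '' (↑(S ⟨j, hj⟩) : Set (Fin n))).ncard ≤ k :=
        (Set.ncard_image_le (Finset.finite_toSet (S ⟨j, hj⟩))).trans (by
          rw [Set.ncard_coe_finset]
          exact hk ⟨j, hj⟩)
      have h2 : D.card ≤ k + 2 :=
        (Finset.card_le_card Finset.sdiff_subset).trans (card_wireSupp_le hk w)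
      omega
    refine 𝔖.sum_indicator_eq D.card _ hpos hpt
      (fun a => ∃ ρ ∈ stabFinset (S ⟨j, hj⟩), (fun i => βA (ρ (d i))) = a ∧ wireValue C G (βA * ρ) w = true)
      (fun b => ∃ ρ ∈ stabFinset (S ⟨j, hj⟩), (fun i => βB (ρ (d i))) = b ∧ wireValue C H (βB * ρ) w = true)
      fun a b hP => ?_
    have hiso := 𝔖.isPartialIso_of_mem hP
    have hab : ∀ i i', a i = a i' ↔ b i = b i' := fun i i' =>
      hiso.eq_iff (x := (a i, b i)) (y := (a i', b i')) (Or.inr ⟨i, rfl⟩) (Or.inr ⟨i', rfl⟩)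
    have habu : ∀ i, ∀ s ∈ S ⟨j, hj⟩, (a i = βA s ↔ b i = βB s) := fun i s hs =>
      hiso.eq_iff (x := (a i, b i)) (y := (βA s, βB s)) (Or.inr ⟨i, rfl⟩)
        (Or.inl ⟨s, Finset.mem_coe.2 hs, rfl⟩)
    have hW : ∀ ρA ρB : Equiv.Perm (Fin n), (∀ s ∈ S ⟨j, hj⟩, ρA s = s) → (∀ s ∈ S ⟨j, hj⟩, ρB s = s) →
        (∀ i, βA (ρA (d i)) = a i) → (∀ i, βB (ρB (d i)) = b i) →
        wireValue C G (βA * ρA) w = wireValue C H (βB * ρB) w := by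
      intro ρA ρB hρA hρB hda hdb
      refine hwire i (βA * ρA) (βB * ρB) (𝔖.mem_of_subset hP ?_)
      rintro _ ⟨s, hs, rfl⟩
      by_cases hsu : s ∈ S ⟨j, hj⟩
      · left
        refine ⟨s, Finset.mem_coe.2 hsu, ?_⟩
        simp only [Equiv.Perm.mul_apply, hρA s hsu, hρB s hsu]
      · right
        obtain ⟨i', rfl⟩ := hcov s (Finset.mem_coe.1 hs) hsu
        refine ⟨i', ?_⟩
        simp only [Equiv.Perm.mul_apply, hda i', hdb i']
    exact ⟨wireValue_transfer (S ⟨j, hj⟩) d hd_inj hdu w βA βB a b hab habu hW,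
      wireValue_transfer (S ⟨j, hj⟩) d hd_inj hdu w βB βA b a (fun i i' => (hab i i').symm)
        (fun i s hs => (habu i s hs).symm)
        (fun ρB ρA hρB hρA hdb hda => (hW ρA ρB hρA hρB hda hdb).symm)⟩
  -- conclude with Claim 28 and cancellation of `|Stab(u)| > 0`
  have hsumG := card_stab_mul_numOnes G hsym hj (hS ⟨j, hj⟩) βA
  have hsumH := card_stab_mul_numOnes H hsym hj (hS ⟨j, hj⟩) βB
  have hpos_card : 0 < (stabFinset (S ⟨j, hj⟩)).card :=
    Finset.card_pos.2 ⟨1, by simp [stabFinset]⟩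
  refine Nat.eq_of_mul_eq_mul_left hpos_card ?_
  rw [hsumG, hsumH]
  exact Finset.sum_congr rfl fun i _ => hcount i

/-- **Symmetric threshold circuits with supports of size `≤ k` do not distinguish
`≡^{C^{2k+2}}`-equivalent graphs** (the per-`n` content of Anderson–Dawar 2017, Thm. 6 /
Dawar–Wilsenach 2025, §6 p. 17, with the explicit constant `2k + 2`). Supports may be re-chosen
empty at the output gate (every automorphism fixes the output), where the empty position is
winning; an output input-wire `x_{pq}` is `Sym(Fin n)`-fixed only if `p = q`, and then reads
`false` on both sides. [cite: DawarWilsenach2025, §6 p. 17 (supports of size k ⇒ counting width O(k))] -/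
theorem eval_adjInput_eq_of_ckEquiv {C : Circuit (Fin n × Fin n)} (hB : C.IsOver tcBasis)
    (hsymC : C.IsSymmetricUnder Set.univ) {k : ℕ}
    (hsupp : ∀ j : Fin C.gates.length, ∃ S : Finset (Fin n), S.card ≤ k ∧
      C.Supports Set.univ (S : Set (Fin n)) j)
    {G H : SimpleGraph (Fin n)} [DecidableRel G.Adj] [DecidableRel H.Adj]
    (hGH : CkEquiv (2 * k + 2) G H) : C.eval (adjInput G) = C.eval (adjInput H) := by
  obtain ⟨𝔖⟩ := hGH
  have hsym : ∀ g ∈ C.gates, g.fn.IsSymmetric := fun g hg => isSymmetric_of_mem_tcBasis (hB g hg)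
  -- supports, emptied at the output gate
  obtain ⟨S, hScard, hS, hSout⟩ : ∃ S : Fin C.gates.length → Finset (Fin n),
      (∀ j, (S j).card ≤ k) ∧ (∀ j, C.Supports Set.univ (↑(S j) : Set (Fin n)) j) ∧
      ∀ j : Fin C.gates.length, C.output = Sum.inr (j : ℕ) → S j = ∅ := by
    classical
    choose S₀ hS₀card hS₀ using hsupp
    refine ⟨fun j => if C.output = Sum.inr (j : ℕ) then ∅ else S₀ j, fun j => ?_, fun j => ?_,
      fun j hj => if_pos hj⟩
    · dsimp only
      by_cases hout : C.output = Sum.inr (j : ℕ)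
      · rw [if_pos hout, Finset.card_empty]
        exact Nat.zero_le _
      · rw [if_neg hout]
        exact hS₀card j
    · dsimp only
      by_cases hout : C.output = Sum.inr (j : ℕ)
      · rw [if_pos hout]
        intro ρ _ _
        obtain ⟨σ, hσ⟩ := hsymC ρ (Set.mem_univ _)
        refine ⟨Set.mem_univ _, σ, hσ, ?_⟩
        have h1 := hσ.1
        rw [hout, Circuit.relabelWire_inr, Circuit.relabelGate_of_lt σ j.2, Sum.inr.injEq] at h1
        exact Fin.ext h1
      · rw [if_neg hout]
        exact hS₀ j
  rw [eval_adjInput_eq_wireValue C G, eval_adjInput_eq_wireValue C H]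
  cases hout : C.output with
  | inl q =>
    obtain ⟨p, q⟩ := q
    have hpq : p = q := by
      obtain ⟨σ, hσ⟩ := hsymC (Equiv.swap p q) (Set.mem_univ _)
      have h1 := hσ.1
      rw [hout, Circuit.relabelWire_inl, Sum.inl.injEq, Prod.mk.injEq, Equiv.swap_apply_left] at h1
      exact h1.1.symm
    subst hpq
    rw [wireValue_inl, wireValue_inl]
    simp
  | inr m =>
    have hm : m < C.gates.length := C.wf_output m hout
    refine wireValue_eq_of_pos_mem hsym hS hScard 𝔖 m hm 1 1 ?_
    rw [hSout ⟨m, hm⟩ hout, Finset.coe_empty, Set.image_empty]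
    exact 𝔖.empty_mem

end Circuits

/-- **DISCHARGE of `AndersonDawar2016_supports_countingWidth`** (Anderson–Dawar 2017, Thm. 6 and
its proof; Dawar–Wilsenach 2025, §6 p. 17: "if a class of graphs `𝒞` is decidable by a family of
symmetric circuits `(C_n)_{n∈ℕ}` with supports of size at most `k(n)` then `𝒞` has counting width
`O(k)`"), with `c = 2` and for every `n`: a class decided by `Sym(Fin n)`-symmetric threshold
circuits whose gates have supports of size `≤ k(n)` is `≡^{C^{2k(n)+2}}`-invariant on `n`-vertex
graphs (`eval_adjInput_eq_of_ckEquiv` and `DecidesGraphClass`). The rigidity and simple-wiring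
hypotheses of the fact are not needed. [cite: DawarWilsenach2025, §6 p. 17; AndersonDawar2016, Thm. 6 (proof, §4.3)] -/
theorem AndersonDawar2016_supports_countingWidth_holds :
    AndersonDawar2016_supports_countingWidth := by
  intro 𝒞 k C hC hdec
  refine ⟨2, Filter.Eventually.of_forall fun n => ?_⟩
  intro G H hGH
  classical
  obtain ⟨hB, hsymC, -, -, hsupp⟩ := hC n
  have key : (C n).eval (adjInput G) = (C n).eval (adjInput H) :=
    eval_adjInput_eq_of_ckEquiv hB hsymC hsupp hGH
  rw [← hdec n G, ← hdec n H, key]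

/-! ## Dawar–Wilsenach 2025, §6: from orbit size to support size to counting width (Thms. 6.3, 6.4)

Towards the named fact `DawarWilsenach2025_orbitSize_countingWidth` (Dawar–Wilsenach, *Symmetric
arithmetic circuits*, Theory of Computing 21 (14) (2025), Thm. 6.4: "Let `𝒞` be a class of graphs
decidable by a family of square symmetric Boolean circuits with threshold gates and with orbit size
`2^{o(n)}`, then `𝒞` has counting width `o(n)`"). The printed proof (pp. 16–18) composes

1. `[2, Lemma 7]` (Anderson–Dawar 2017; Lemma 24 of arXiv:1401.1125): rigidification of a
   symmetric threshold circuit, which "does not increase orbit size" (p. 18);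
2. **Thm. 6.2** `= [16, Thm. 4.10]` (Dawar–Wilsenach, *Symmetric circuits for rank logic*, ACM
   ToCL 23 (2022)): "Let `C` be a rigid square-symmetric Boolean circuit with order `n > 8`. For
   every `1 ≤ k ≤ n/4` if the maximum size of an orbit in `C` is bounded by `(n choose k)` then each
   gate in `C` has a support of size less than `k`";
3. **Thm. 6.3** (proved there from 2.): `ORB(C_n) = 2^{o(n)}` ⇒ `SP(C_n) = o(n)`, through
   `(n choose k) ≥ (n/k)^k ≥ 2^k` for `k ≤ n/2`;
4. `[2, Thm. 6]`: supports of size `k(n)` give counting width `O(k)` —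
   `AndersonDawar2016_supports_countingWidth_holds` / `eval_adjInput_eq_of_ckEquiv` above.

PROVED below: step 4 in the `o`-form actually used ("support size `o(n)` ⇒ counting width `o(n)`",
`DawarWilsenach2025_countingWidth_littleO_of_supportSize_littleO`, from `eval_adjInput_eq_of_ckEquiv`,
so neither rigidity nor simple wiring is needed there), step 3, and the assembly of Thm. 6.4, with
the external theorems 1 and 2 — not in the tree — entering as explicit hypotheses stated in the
tree's vocabulary (`DawarWilsenach2025_supportSize_littleO_of_supportTheorem`,
`DawarWilsenach2025_orbitSize_countingWidth_rigid_of_supportTheorem`,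
`DawarWilsenach2025_orbitSize_countingWidth.of_rigidification_of_supportTheorem`). Discharging the
named fact is thereby reduced to vendoring and proving 1 and 2 (or 2 alone in a form for the tree's
not necessarily rigid circuits, `DawarWilsenach2025_orbitSize_countingWidth.of_supportTheorem`).

THE FORM OF THE SUPPORT-THEOREM HYPOTHESIS. Thm. 6.2 is quoted above verbatim; read literally
("orbit size `≤ (n choose k)` ⇒ a support of size `< k`") it FAILS at the boundary
`ORB = (n choose k)`. For the tree's circuits (inputs are wires): with `n = 9`, `k = 1`, the nine
gates `∧₁(x_{uu})`, `u ∈ Fin 9`, under one disjunction form a rigid, `Sym(Fin 9)`-symmetric,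
simply wired `tcBasis`-circuit of orbit size `9 = (9 choose 1)` whose gates `∧₁(x_{uu})` are
moved by automorphisms, so that none of them has a support of size `0 < k`. In the printed model
(inputs are gates, with orbits of size up to `n(n-1)`, so that the hypothesis forces `k ≥ 3`):
with `n = 12`, `k = 3 = n/4`, the `(12 choose 3)` conjunctions `g_B = ∧_{u ≠ v ∈ B} x_{uv}`
(`B` a `3`-subset) under one disjunction form a rigid symmetric circuit of orbit size exactly
`(12 choose 3) = 220 ≥ 132`, and `g_B` has no support of size `2` (a transposition moving one
point of `B` outside `B ∪ S` fixes any `2`-set `S`). Dawar–Wilsenach themselves use Thm. 6.2 in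
the proof of Thm. 6.3 to pass from
`ORB(C_n) ≤ (n choose k)` to `SP(C_n) ≤ k` (sic: `≤`, p. 17), i.e. in a reading where either both
inequalities are strict (`[16, Thm. 4.10]` applied at `k + 1`, using
`(n choose k) < (n choose k+1)` for `k + 1 ≤ n/2`) or both are weak. The hypothesis `hsupp` below
is therefore the consequence COMMON TO BOTH READINGS — for `1 ≤ k`, `k + 1 ≤ n/4` and orbit size
`≤ (n choose k)`, every gate has a support of size `≤ k` — which is all the asymptotic argument
needs, and which is satisfiable (it holds in the boundary example).
Sources read: [DawarWilsenach2025] pp. 16–18 (§6: Def. 6.1, Thms. 6.2–6.4 and their proofs, the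
rigidity remark on p. 18); [AndersonDawar2016] arXiv text §4.1 (Lemma 24). No definition or named
fact is introduced. -/

section OrbitToCountingWidth

open Filter

/-- `2^k ≤ (2k choose k)` (induction on `k` with Pascal's rule: `(2k+2 choose k+1) =
2·(2k+1 choose k) ≥ 2·(2k choose k)`). [folklore] -/
theorem two_pow_le_choose_two_mul_self (k : ℕ) : 2 ^ k ≤ (2 * k).choose k := by
  induction k with
  | zero => simp
  | succ k ih =>
    have h1 : (2 * k).choose k ≤ (2 * k + 1).choose k := Nat.choose_mono k (by omega)
    have h2 : (2 * k + 1).choose (k + 1) = (2 * k + 1).choose k := Nat.choose_symm_half k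
    have h3 : (2 * (k + 1)).choose (k + 1) =
        (2 * k + 1).choose k + (2 * k + 1).choose (k + 1) := by
      rw [show 2 * (k + 1) = (2 * k + 1) + 1 by ring, Nat.choose_succ_succ]
    rw [h3, h2, pow_succ]
    omega

/-- **`2^k ≤ (n choose k)` for `2k ≤ n`** — the inequality `(n choose k) ≥ (n/k)^k ≥ 2^k`
behind Dawar–Wilsenach 2025, proof of Thm. 6.3 ("since `(n choose cn) ≥ (n/(cn))^{cn}` for all
`c` it follows that `(n choose k-1) ≥ … > 2^{cn}`", there with `c < 1/2`).
[cite: DawarWilsenach2025, Thm. 6.3 (proof)] -/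
theorem two_pow_le_choose_of_two_mul_le {n k : ℕ} (h : 2 * k ≤ n) : 2 ^ k ≤ n.choose k :=
  (two_pow_le_choose_two_mul_self k).trans (Nat.choose_mono k h)

/-- **The asymptotic extraction of Dawar–Wilsenach 2025, Thm. 6.3** (its elementary core, for an
arbitrary sequence `s` of natural numbers in place of `ORB(C_n)`): if `s(n) = 2^{o(n)}` — for
every `ε > 0`, eventually `s(n) ≤ 2^{εn}` — then for every `δ > 0` and all large `n` there is
`k` with `1 ≤ k ≤ n/4`, `k ≤ δn` and `s(n) ≤ (n choose k)` (take `k = ⌈εn⌉` with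
`ε = min(δ, 1/4)/2` and use `2^k ≤ (n choose k)` for `2k ≤ n`). This is exactly the shape of the
hypothesis of Thm. 6.2 (`1 ≤ k ≤ n/4`, orbit size at most `(n choose k)`), with `k = o(n)`.
[cite: DawarWilsenach2025, Thm. 6.3 (proof)] -/
theorem eventually_exists_le_choose_of_subexponential {s : ℕ → ℕ}
    (hs : ∀ ε : ℝ, 0 < ε → ∀ᶠ n : ℕ in atTop, (s n : ℝ) ≤ (2 : ℝ) ^ (ε * (n : ℝ)))
    {δ : ℝ} (hδ : 0 < δ) :
    ∀ᶠ n : ℕ in atTop, ∃ k : ℕ, 1 ≤ k ∧ k ≤ n / 4 ∧ (k : ℝ) ≤ δ * n ∧ s n ≤ n.choose k := by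
  set δ' : ℝ := min δ (1 / 4) with hδ'_def
  have hδ'pos : 0 < δ' := lt_min hδ (by norm_num)
  have hδ'le : δ' ≤ δ := min_le_left _ _
  have hδ'4 : δ' ≤ 1 / 4 := min_le_right _ _
  have h1 := hs (δ' / 2) (by positivity)
  have h2 : ∀ᶠ n : ℕ in atTop, (2 / δ' : ℝ) ≤ n :=
    tendsto_natCast_atTop_atTop.eventually_ge_atTop _
  filter_upwards [h1, h2] with n hn hn2
  have hn0 : (0 : ℝ) ≤ δ' / 2 * n := by positivity
  have hδ'n : (1 : ℝ) ≤ δ' / 2 * n := by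
    have h := mul_le_mul_of_nonneg_left hn2 (le_of_lt (half_pos hδ'pos))
    rwa [show δ' / 2 * (2 / δ') = (1 : ℝ) by field_simp] at h
  have hn8 : (8 : ℝ) ≤ n := by
    refine le_trans ?_ hn2
    rw [le_div_iff₀ hδ'pos]
    linarith
  set k : ℕ := ⌈δ' / 2 * (n : ℝ)⌉₊ with hk_def
  have hk_ge : δ' / 2 * (n : ℝ) ≤ k := Nat.le_ceil _
  have hk_lt : (k : ℝ) < δ' / 2 * n + 1 := Nat.ceil_lt_add_one hn0
  have hkδ' : (k : ℝ) ≤ δ' * n := by linarith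
  have h4k : 4 * k ≤ n := by
    have h : (4 : ℝ) * k ≤ n := by nlinarith
    exact_mod_cast h
  refine ⟨k, Nat.ceil_pos.2 (by linarith), (Nat.le_div_iff_mul_le (by norm_num)).2 (by omega),
    hkδ'.trans (mul_le_mul_of_nonneg_right hδ'le (Nat.cast_nonneg n)), ?_⟩
  have hpow : (2 : ℝ) ^ (δ' / 2 * (n : ℝ)) ≤ (2 : ℝ) ^ (k : ℝ) :=
    Real.rpow_le_rpow_of_exponent_le (by norm_num) hk_ge
  have hchoose : 2 ^ k ≤ n.choose k := two_pow_le_choose_of_two_mul_le (by omega)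
  have h : (s n : ℝ) ≤ (n.choose k : ℕ) := by
    calc (s n : ℝ) ≤ (2 : ℝ) ^ (δ' / 2 * (n : ℝ)) := hn
      _ ≤ (2 : ℝ) ^ (k : ℝ) := hpow
      _ = ((2 ^ k : ℕ) : ℝ) := by rw [Real.rpow_natCast]; push_cast; rfl
      _ ≤ (n.choose k : ℕ) := by exact_mod_cast hchoose
  exact_mod_cast h

/-- `2^{o(n)} + n² = 2^{o(n)}`: a subexponential sequence stays subexponential after adding `n²`
(with `r = 2^{ε/2} > 1`: eventually `n² ≤ r^n / 4` — polynomials are `o(r^n)`,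
`tendsto_pow_const_div_const_pow_of_one_lt` — and `r^n ≥ 2`, so
`s(n) + n² ≤ (5/4) r^n ≤ (r^n)² = 2^{εn}`). [folklore] -/
theorem eventually_add_sq_le_two_rpow {s : ℕ → ℕ}
    (hs : ∀ ε : ℝ, 0 < ε → ∀ᶠ n : ℕ in atTop, (s n : ℝ) ≤ (2 : ℝ) ^ (ε * (n : ℝ)))
    {ε : ℝ} (hε : 0 < ε) :
    ∀ᶠ n : ℕ in atTop, ((s n + n ^ 2 : ℕ) : ℝ) ≤ (2 : ℝ) ^ (ε * (n : ℝ)) := by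
  set r : ℝ := (2 : ℝ) ^ (ε / 2) with hr
  have hr1 : 1 < r := Real.one_lt_rpow (by norm_num) (half_pos hε)
  have hrpow : ∀ n : ℕ, (2 : ℝ) ^ (ε / 2 * (n : ℝ)) = r ^ n := fun n =>
    Real.rpow_mul_natCast (by norm_num) (ε / 2) n
  have h1 : ∀ᶠ n : ℕ in atTop, (n : ℝ) ^ 2 / r ^ n ≤ 1 / 4 :=
    (tendsto_pow_const_div_const_pow_of_one_lt 2 hr1).eventually (ge_mem_nhds (by norm_num))
  have h2 : ∀ᶠ n : ℕ in atTop, (2 / ε : ℝ) ≤ n :=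
    tendsto_natCast_atTop_atTop.eventually_ge_atTop _
  filter_upwards [hs (ε / 2) (half_pos hε), h1, h2] with n hn hn1 hn2
  have hrn : (0 : ℝ) < r ^ n := pow_pos (by linarith) n
  rw [hrpow] at hn
  rw [div_le_iff₀ hrn] at hn1
  have hεn : (2 : ℝ) ^ (ε * (n : ℝ)) = (r ^ n) ^ 2 := by
    rw [← hrpow n, ← Real.rpow_natCast, ← Real.rpow_mul (by norm_num)]
    congr 1
    push_cast
    ring
  have hge2 : (2 : ℝ) ≤ r ^ n := by
    rw [← hrpow n]
    have h : (1 : ℝ) ≤ ε / 2 * (n : ℝ) := by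
      rw [div_le_iff₀ hε] at hn2
      nlinarith
    calc (2 : ℝ) = 2 ^ (1 : ℝ) := (Real.rpow_one 2).symm
      _ ≤ 2 ^ (ε / 2 * (n : ℝ)) := Real.rpow_le_rpow_of_exponent_le (by norm_num) h
  rw [hεn]
  push_cast
  nlinarith [hge2, hn, hn1, hrn]

/-- Every gate of a circuit on `n × n` matrix inputs has a support of size at most `n` relative
to `Sym(Fin n)` — the whole index set (`Circuit.supports_univ`) — so the support size `SP(C)` of
Dawar–Wilsenach 2025, Def. 6.1 is well defined and at most `n`. [folklore] -/
theorem _root_.Literature.Computability.Complexity.Circuit.forall_exists_supports_card_le_self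
    {n : ℕ} (C : Circuit (Fin n × Fin n)) :
    ∀ j : Fin C.gates.length, ∃ S : Finset (Fin n), S.card ≤ n ∧
      C.Supports Set.univ (S : Set (Fin n)) j :=
  fun j => ⟨Finset.univ, by simp, by simpa using C.supports_univ (Set.mem_univ _) j⟩

/-- **Support size `o(n)` gives counting width `o(n)`** — the form in which Dawar–Wilsenach 2025
use `[2, Thm. 6]` on p. 17 ("if a class of graphs `𝒞` is decidable by a family of symmetric
circuits `(C_n)_{n∈ℕ}` with supports of size at most `k(n)` then `𝒞` has counting width `O(k)`",
applied with `k(n) = o(n)`), PROVED for the tree's circuits from `eval_adjInput_eq_of_ckEquiv`: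
if `C = (C_n)` is a family of `Sym(Fin n)`-symmetric `tcBasis`-circuits on `n × n` inputs deciding
`𝒞` on adjacency matrices and, for every `δ > 0` and all large `n`, every gate of `C_n` has a
support of size at most `δn`, then for every `ε > 0` and all large `n`, `𝒞` is `≡^{C^k}`-invariant
on `n`-vertex graphs for every `k ≥ εn`. (With `K = ⌈εn/4⌉ ≥` all support sizes, `2K + 2 ≤ εn ≤ k`
for large `n`, and `CkEquiv.mono`.) Neither rigidity nor simple wiring is assumed.
[cite: DawarWilsenach2025, §6 p. 17 (supports of size k(n) ⇒ counting width O(k))] -/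
theorem DawarWilsenach2025_countingWidth_littleO_of_supportSize_littleO {𝒞 : Set FinGraph}
    {C : ∀ n : ℕ, Circuit (Fin n × Fin n)}
    (hC : ∀ n, (C n).IsOver tcBasis ∧ (C n).IsSymmetricUnder Set.univ)
    (hdec : DecidesGraphClass 𝒞 C)
    (hSP : ∀ δ : ℝ, 0 < δ → ∀ᶠ n : ℕ in atTop, ∀ j : Fin (C n).gates.length,
      ∃ S : Finset (Fin n), (S.card : ℝ) ≤ δ * n ∧ (C n).Supports Set.univ (S : Set (Fin n)) j)
    {ε : ℝ} (hε : 0 < ε) :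
    ∀ᶠ n : ℕ in atTop, ∀ k : ℕ, ε * (n : ℝ) ≤ (k : ℝ) → IsCkInvariantAt 𝒞 n k := by
  have h8 : ∀ᶠ n : ℕ in atTop, (8 / ε : ℝ) ≤ n :=
    tendsto_natCast_atTop_atTop.eventually_ge_atTop _
  filter_upwards [hSP (ε / 4) (by positivity), h8] with n hn hn8 k hk G H hGH
  classical
  -- all supports have size at most `K = ⌈(ε/4) n⌉`, and `2K + 2 ≤ εn ≤ k`
  set K : ℕ := ⌈ε / 4 * (n : ℝ)⌉₊ with hK_def
  have hKn : (K : ℝ) < ε / 4 * n + 1 := Nat.ceil_lt_add_one (by positivity)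
  have hsupp : ∀ j : Fin (C n).gates.length, ∃ S : Finset (Fin n), S.card ≤ K ∧
      (C n).Supports Set.univ (S : Set (Fin n)) j := fun j => by
    obtain ⟨S, hS, hsup⟩ := hn j
    exact ⟨S, Nat.cast_le.1 (hS.trans (Nat.le_ceil _)), hsup⟩
  have h2K : 2 * K + 2 ≤ k := by
    have h1 : (8 : ℝ) ≤ ε * n := by
      rw [div_le_iff₀ hε] at hn8
      linarith
    have h : ((2 * K + 2 : ℕ) : ℝ) ≤ k := by
      push_cast
      linarith
    exact_mod_cast h
  rw [← hdec n G, ← hdec n H, eval_adjInput_eq_of_ckEquiv (hC n).1 (hC n).2 hsupp (hGH.mono h2K)]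

/-- **Dawar–Wilsenach 2025, Theorem 6.3, conditional on Theorem 6.2.** "Let `(C_n)_{n∈ℕ}` be a
family of rigid square-symmetric Boolean circuits over the threshold basis. If
`ORB(C_n) = 2^{o(n)}` then `SP(C_n) = o(n)`." Here: for simply wired rigid `Sym(Fin n)`-symmetric
`tcBasis`-circuits on `n × n` inputs with, for every `ε > 0`, eventually `ORB(C_n) ≤ 2^{εn}`
(`Circuit.orbitSize univ`), one has, for every `δ > 0` and all large `n`, that every gate of `C_n`
has a support of size at most `δn` (`SP(C_n) ≤ δn`). The hypothesis `hsupp` stands for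
**Theorem 6.2** of the source, i.e. `[16, Thm. 4.10]` (Dawar–Wilsenach, *Symmetric circuits for
rank logic*, ACM ToCL 23 (2022)), NOT in the tree and therefore taken as an explicit hypothesis,
in the form common to the strict and the weak reading of the printed "if the maximum size of an
orbit in `C` is bounded by `(n choose k)` then each gate in `C` has a support of size less than
`k`" (`1 ≤ k ≤ n/4`, `n > 8`; see the discussion heading this section): for a rigid
square-symmetric circuit of order `n > 8` and `1 ≤ k` with `k + 1 ≤ n/4`
(natural-number division: `4(k+1) ≤ n`), if the orbit size is at most `(n choose k)` then every
gate has a support of size at most `k` — asked only of simply wired `tcBasis`-circuits, which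
weakens the hypothesis further. Proof as printed: the least `k` with `ORB(C_n) ≤ (n choose k)` is
`o(n)` (`eventually_exists_le_choose_of_subexponential`, run with `min δ (1/8)` so that also
`k + 1 ≤ n/4`), and Thm. 6.2 applies. [cite: DawarWilsenach2025, Thm. 6.3] -/
theorem DawarWilsenach2025_supportSize_littleO_of_supportTheorem
    (hsupp : ∀ (n : ℕ) (C : Circuit (Fin n × Fin n)), 8 < n → C.IsOver tcBasis →
      C.IsSymmetricUnder Set.univ → C.IsRigid → C.HasSimpleWiring →
      ∀ k : ℕ, 1 ≤ k → k + 1 ≤ n / 4 → C.orbitSize Set.univ ≤ n.choose k →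
      ∀ j : Fin C.gates.length, ∃ S : Finset (Fin n), S.card ≤ k ∧
        C.Supports Set.univ (S : Set (Fin n)) j)
    {C : ∀ n : ℕ, Circuit (Fin n × Fin n)}
    (hC : ∀ n, (C n).IsOver tcBasis ∧ (C n).IsSymmetricUnder Set.univ ∧ (C n).IsRigid ∧
      (C n).HasSimpleWiring)
    (horb : ∀ ε : ℝ, 0 < ε →
      ∀ᶠ n : ℕ in atTop, ((C n).orbitSize Set.univ : ℝ) ≤ (2 : ℝ) ^ (ε * (n : ℝ)))
    {δ : ℝ} (hδ : 0 < δ) :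
    ∀ᶠ n : ℕ in atTop, ∀ j : Fin (C n).gates.length,
      ∃ S : Finset (Fin n), (S.card : ℝ) ≤ δ * n ∧ (C n).Supports Set.univ (S : Set (Fin n)) j := by
  have hδ' : 0 < min δ (1 / 8) := lt_min hδ (by norm_num)
  filter_upwards [eventually_exists_le_choose_of_subexponential horb hδ', eventually_gt_atTop 8]
    with n hn hn8 j
  obtain ⟨k, hk1, -, hkδ, hks⟩ := hn
  have hkδn : (k : ℝ) ≤ δ * n :=
    hkδ.trans (mul_le_mul_of_nonneg_right (min_le_left _ _) (Nat.cast_nonneg n))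
  have h8k : 8 * k ≤ n := by
    have h : (8 : ℝ) * k ≤ n := by
      have := hkδ.trans (mul_le_mul_of_nonneg_right (min_le_right _ _) (Nat.cast_nonneg n))
      linarith
    exact_mod_cast h
  have hk4 : k + 1 ≤ n / 4 := (Nat.le_div_iff_mul_le (by norm_num)).2 (by omega)
  obtain ⟨S, hS, hsup⟩ :=
    hsupp n (C n) hn8 (hC n).1 (hC n).2.1 (hC n).2.2.1 (hC n).2.2.2 k hk1 hk4 hks j
  exact ⟨S, le_trans (by exact_mod_cast hS) hkδn, hsup⟩

/-- **Dawar–Wilsenach 2025, Theorem 6.4 for RIGID families, conditional on Theorem 6.2.** For a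
class `𝒞` of graphs decided (`DecidesGraphClass`) by a family of simply wired, rigid,
`Sym(Fin n)`-symmetric `tcBasis`-circuits of orbit size `2^{o(n)}`, the counting width of `𝒞` is
`o(n)` in the invariance form of `DawarWilsenach2025_orbitSize_countingWidth`: for every `ε > 0`
and all large `n`, `𝒞` is `≡^{C^k}`-invariant on `n`-vertex graphs for every `k ≥ εn`.
Hypothesis: `hsupp` = Thm. 6.2 (`[16, Thm. 4.10]`) in the form explained at
`DawarWilsenach2025_supportSize_littleO_of_supportTheorem`. Proof as printed (p. 17): Thm. 6.3
gives `SP(C_n) = o(n)`, and support size `o(n)` gives counting width `o(n)`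
(`DawarWilsenach2025_countingWidth_littleO_of_supportSize_littleO`, i.e. `[2, Thm. 6]`).
[cite: DawarWilsenach2025, Thm. 6.4 (proof, p. 17)] -/
theorem DawarWilsenach2025_orbitSize_countingWidth_rigid_of_supportTheorem
    (hsupp : ∀ (n : ℕ) (C : Circuit (Fin n × Fin n)), 8 < n → C.IsOver tcBasis →
      C.IsSymmetricUnder Set.univ → C.IsRigid → C.HasSimpleWiring →
      ∀ k : ℕ, 1 ≤ k → k + 1 ≤ n / 4 → C.orbitSize Set.univ ≤ n.choose k →
      ∀ j : Fin C.gates.length, ∃ S : Finset (Fin n), S.card ≤ k ∧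
        C.Supports Set.univ (S : Set (Fin n)) j)
    (𝒞 : Set FinGraph) (C : ∀ n : ℕ, Circuit (Fin n × Fin n))
    (hC : ∀ n, (C n).IsOver tcBasis ∧ (C n).IsSymmetricUnder Set.univ ∧ (C n).IsRigid ∧
      (C n).HasSimpleWiring)
    (hdec : DecidesGraphClass 𝒞 C)
    (horb : ∀ ε : ℝ, 0 < ε →
      ∀ᶠ n : ℕ in atTop, ((C n).orbitSize Set.univ : ℝ) ≤ (2 : ℝ) ^ (ε * (n : ℝ)))
    {ε : ℝ} (hε : 0 < ε) :
    ∀ᶠ n : ℕ in atTop, ∀ k : ℕ, ε * (n : ℝ) ≤ (k : ℝ) → IsCkInvariantAt 𝒞 n k :=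
  DawarWilsenach2025_countingWidth_littleO_of_supportSize_littleO (fun n => ⟨(hC n).1, (hC n).2.1⟩)
    hdec (fun _ hδ => DawarWilsenach2025_supportSize_littleO_of_supportTheorem hsupp hC horb hδ) hε

/-- **Dawar–Wilsenach 2025, Theorem 6.4, conditional on `[2, Lemma 7]` and Theorem 6.2.**
The named fact `DawarWilsenach2025_orbitSize_countingWidth` follows from:
`hrig` = the rigidification lemma `[2, Lemma 7]` as used on p. 18 ("any symmetric Boolean
circuit over the threshold basis may be converted into an equivalent rigid symmetric circuit …
the conversion does not increase orbit size"), stated for the tree's circuits — every simply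
wired `Sym(Fin n)`-symmetric `tcBasis`-circuit on `n × n` inputs has a simply wired, RIGID,
`Sym(Fin n)`-symmetric `tcBasis`-circuit computing the same function, of orbit size at most the
old orbit size PLUS `n²`. The slack `n²` (immaterial for `2^{o(n)}`,
`eventually_add_sq_le_two_rpow`) accounts for a difference of models: in print the inputs
`x_{uv}` are GATES, whose orbits (of size `< n²`) count towards `ORB(C)`, whereas the tree's
inputs are wires, so that a conversion introducing gates attached to single inputs (such as the
single-input `AND` chains in the proof of Lemma 24 of arXiv:1401.1125, the arXiv form of
`[2, Lemma 7]`) may create orbits of size up to `n²` not dominated by `Circuit.orbitSize`; the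
printed "does not increase orbit size" implies this form. `hsupp` = Thm. 6.2
(`[16, Thm. 4.10]`) in the form explained at
`DawarWilsenach2025_supportSize_littleO_of_supportTheorem`. Neither is in the tree yet; this
theorem is the printed assembly (rigidify, then
`DawarWilsenach2025_orbitSize_countingWidth_rigid_of_supportTheorem`), so that discharging the
named fact amounts to vendoring and proving these two. [cite: DawarWilsenach2025, Thm. 6.4 (proof, pp. 17–18)] -/
theorem DawarWilsenach2025_orbitSize_countingWidth.of_rigidification_of_supportTheorem
    (hrig : ∀ (n : ℕ) (C : Circuit (Fin n × Fin n)), C.IsOver tcBasis →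
      C.IsSymmetricUnder Set.univ → C.HasSimpleWiring →
      ∃ C' : Circuit (Fin n × Fin n), C'.IsOver tcBasis ∧ C'.IsSymmetricUnder Set.univ ∧
        C'.IsRigid ∧ C'.HasSimpleWiring ∧ (∀ x, C'.eval x = C.eval x) ∧
        C'.orbitSize Set.univ ≤ C.orbitSize Set.univ + n ^ 2)
    (hsupp : ∀ (n : ℕ) (C : Circuit (Fin n × Fin n)), 8 < n → C.IsOver tcBasis →
      C.IsSymmetricUnder Set.univ → C.IsRigid → C.HasSimpleWiring →
      ∀ k : ℕ, 1 ≤ k → k + 1 ≤ n / 4 → C.orbitSize Set.univ ≤ n.choose k →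
      ∀ j : Fin C.gates.length, ∃ S : Finset (Fin n), S.card ≤ k ∧
        C.Supports Set.univ (S : Set (Fin n)) j) :
    DawarWilsenach2025_orbitSize_countingWidth := by
  intro 𝒞 C hC hdec horb ε hε
  choose C' hC' using fun n => hrig n (C n) (hC n).1 (hC n).2.1 (hC n).2.2
  refine DawarWilsenach2025_orbitSize_countingWidth_rigid_of_supportTheorem hsupp 𝒞 C'
    (fun n => ⟨(hC' n).1, (hC' n).2.1, (hC' n).2.2.1, (hC' n).2.2.2.1⟩) ?_ ?_ hε
  · intro n G _
    rw [(hC' n).2.2.2.2.1]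
    exact hdec n G
  · intro δ hδ
    filter_upwards [eventually_add_sq_le_two_rpow horb hδ] with n hn
    exact le_trans (by exact_mod_cast (hC' n).2.2.2.2.2) hn

/-- **Dawar–Wilsenach 2025, Theorem 6.4, conditional on a support theorem for the tree's (not
necessarily rigid) symmetric circuits** — a reduction lemma, not a citation: since
`eval_adjInput_eq_of_ckEquiv` needs neither rigidity nor simple wiring, the named fact also
follows from Thm. 6.2 ALONE once that is available (in the form explained at
`DawarWilsenach2025_supportSize_littleO_of_supportTheorem`) for `Sym(Fin n)`-symmetric simply
wired `tcBasis`-circuits with supports in the sense of `Circuit.Supports` (every permutation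
fixing `S` pointwise has SOME extension to an automorphism fixing the gate) — the form a
rigidification-free vendoring of `[16, Thm. 4.10]` would take; for rigid circuits it is the
printed setting. [cite: DawarWilsenach2025, Thm. 6.4 (proof, pp. 17–18)] -/
theorem DawarWilsenach2025_orbitSize_countingWidth.of_supportTheorem
    (hsupp : ∀ (n : ℕ) (C : Circuit (Fin n × Fin n)), 8 < n → C.IsOver tcBasis →
      C.IsSymmetricUnder Set.univ → C.HasSimpleWiring →
      ∀ k : ℕ, 1 ≤ k → k + 1 ≤ n / 4 → C.orbitSize Set.univ ≤ n.choose k →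
      ∀ j : Fin C.gates.length, ∃ S : Finset (Fin n), S.card ≤ k ∧
        C.Supports Set.univ (S : Set (Fin n)) j) :
    DawarWilsenach2025_orbitSize_countingWidth := by
  intro 𝒞 C hC hdec horb ε hε
  refine DawarWilsenach2025_countingWidth_littleO_of_supportSize_littleO
    (fun n => ⟨(hC n).1, (hC n).2.1⟩) hdec (fun δ hδ => ?_) hε
  have hδ' : 0 < min δ (1 / 8) := lt_min hδ (by norm_num)
  filter_upwards [eventually_exists_le_choose_of_subexponential horb hδ', eventually_gt_atTop 8]
    with n hn hn8 j
  obtain ⟨k, hk1, -, hkδ, hks⟩ := hn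
  have hkδn : (k : ℝ) ≤ δ * n :=
    hkδ.trans (mul_le_mul_of_nonneg_right (min_le_left _ _) (Nat.cast_nonneg n))
  have h8k : 8 * k ≤ n := by
    have h : (8 : ℝ) * k ≤ n := by
      have := hkδ.trans (mul_le_mul_of_nonneg_right (min_le_right _ _) (Nat.cast_nonneg n))
      linarith
    exact_mod_cast h
  have hk4 : k + 1 ≤ n / 4 := (Nat.le_div_iff_mul_le (by norm_num)).2 (by omega)
  obtain ⟨S, hS, hsup⟩ := hsupp n (C n) hn8 (hC n).1 (hC n).2.1 (hC n).2.2 k hk1 hk4 hks j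
  exact ⟨S, le_trans (by exact_mod_cast hS) hkδn, hsup⟩

end OrbitToCountingWidth

/-! ### Theorem 6.4 discharged (Theorem 6.2 = the Support Theorem and `[2, Lemma 7]` now in the tree)

With the rigidification `[2, Lemma 7]` (`Literature.Computability.Complexity.CircuitReduce`:
`GateDAG.reduce`, producing REDUCED — hence rigid — simply wired symmetric circuits) and the
Support Theorem of `[16, Thm 4.10]` for reduced symmetric circuits
(`Literature.Computability.Complexity.SupportTheorem`, from Dixon–Mortimer Thm 5.2B), the named fact
`DawarWilsenach2025_orbitSize_countingWidth` is a theorem.  The support theorem is applied to the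
reduced circuits (the printed setting: `[16]` states it for "injective symmetric circuits with
unique extensions"), so the assembly below runs the printed argument directly on them rather than
through `of_rigidification_of_supportTheorem` (whose hypothesis `hsupp` quantifies over all rigid
circuits). -/

section Discharge

open Filter Literature.Computability.Complexity

/-- **Reduced rigidification with the Support Theorem attached** (`[2, Lemma 7]` + `[16, Thm 4.10]`
for the tree's circuits): every `Sym(Fin n)`-symmetric `tcBasis`-circuit on `n × n` inputs has a
`Sym(Fin n)`-symmetric `tcBasis`-circuit computing the same function, of orbit size at most the old
one plus `n²`, in which — whenever `n > 8`, `1 ≤ k`, `k + 1 ≤ n/4` and its orbit size is at most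
`C(n, k)` — every gate has a support of size at most `k`.  Construction: the compiled reduced DAG
`(GateDAG.ofCircuit C).reduce.compile`; supports by `GateDAG.compile_supports`.
[cite: DawarWilsenach2025, Thm. 6.2 and §6 p. 18; DawarWilsenach2021, §4 Thm (support-theorem); AndersonDawar2016, Lemma 7] -/
theorem exists_reduced_rigidification_supports {n : ℕ} (C : Circuit (Fin n × Fin n))
    (hB : C.IsOver tcBasis) (hsym : C.IsSymmetricUnder Set.univ) :
    ∃ C' : Circuit (Fin n × Fin n), C'.IsOver tcBasis ∧ C'.IsSymmetricUnder Set.univ ∧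
      (∀ x, C'.eval x = C.eval x) ∧ C'.orbitSize Set.univ ≤ C.orbitSize Set.univ + n ^ 2 ∧
      (8 < n → ∀ k : ℕ, 1 ≤ k → k + 1 ≤ n / 4 → C'.orbitSize Set.univ ≤ n.choose k →
        ∀ j : Fin C'.gates.length, ∃ S : Finset (Fin n), S.card ≤ k ∧
          C'.Supports Set.univ (S : Set (Fin n)) j) := by
  classical
  let D := GateDAG.ofCircuit C
  have hfB : ∀ l, D.fn l ∈ tcBasis := (GateDAG.isOver_iff_ofCircuit C _).1 hB
  have hfs : ∀ l, (D.fn l).IsSymmetric := fun l => isSymmetric_of_mem_tcBasis (hfB l)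
  have hDs : D.IsSymm (GateDAG.diagMaps Set.univ) := (GateDAG.isSymmetricUnder_iff_ofCircuit C _).1 hsym
  have hdiag : ∀ ρ : Equiv.Perm (Fin n),
      (⇑(Equiv.prodCongr ρ ρ) : Fin n × Fin n → Fin n × Fin n) = fun q => (ρ q.1, ρ q.2) :=
    fun ρ => funext fun q => rfl
  let A : Set (Equiv.Perm (Fin n × Fin n) × (Fin C.gates.length ≃ Fin C.gates.length)) :=
    {a | D.IsAut (⇑a.1) a.2 ∧ ∃ ρ : Equiv.Perm (Fin n), a.1 = Equiv.prodCongr ρ ρ}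
  have hA : ∀ a ∈ A, D.IsAut (⇑a.1) a.2 := fun a ha => ha.1
  have hcov : ∀ π ∈ GateDAG.diagMaps (Set.univ : Set (Equiv.Perm (Fin n))), ∃ a ∈ A,
      (⇑a.1 : Fin n × Fin n → Fin n × Fin n) = π := by
    rintro π ⟨ρ, -, rfl⟩
    obtain ⟨θ, hθ⟩ := hDs _ (GateDAG.diag_mem_diagMaps (Set.mem_univ ρ))
    refine ⟨(Equiv.prodCongr ρ ρ, θ), ⟨?_, ρ, rfl⟩, hdiag ρ⟩
    show D.IsAut (⇑(Equiv.prodCongr ρ ρ)) θ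
    rw [hdiag]; exact hθ
  have hEs : D.reduce.IsSymm (GateDAG.diagMaps Set.univ) := by
    intro π hπ
    obtain ⟨a, ha, rfl⟩ := hcov π hπ
    exact ⟨_, (hA a ha).reduce⟩
  refine ⟨D.reduce.compile, ?_, ?_, ?_, ?_, ?_⟩
  · exact D.reduce.compile_isOver (D.reduce_fn_mem hfB and_one_mem_tcBasis)
  · rw [GateDAG.isSymmetricUnder_compile_iff]; exact hEs
  · intro x
    rw [GateDAG.compile_eval, GateDAG.evalOut_reduce _ hfs, GateDAG.evalOut_ofCircuit]
  · refine D.reduce.orbitSize_compile_le _ fun g => ?_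
    have hs : ∀ l, (GateDAG.traced A l).ncard ≤ C.orbitSize Set.univ := by
      intro l
      refine le_trans (Set.ncard_le_ncard (GateDAG.traced_subset_orbit A (P := GateDAG.diagMaps Set.univ)
        (fun a ha => ⟨ha.1, ?_⟩) l) (Set.toFinite _)) ?_
      · obtain ⟨ρ, hρ⟩ := ha.2
        exact ⟨ρ, Set.mem_univ ρ, by rw [hρ, hdiag]⟩
      · rw [← GateDAG.gateOrbit_eq_orbit_ofCircuit]
        exact C.ncard_gateOrbit_le_orbitSize _ l
    refine (GateDAG.ncard_orbit_reduce_le A hA hcov hs g).trans (max_le (Nat.le_add_right _ _) ?_)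
    rw [Fintype.card_prod, Fintype.card_fin, sq]
    exact Nat.le_add_left _ _
  · intro hn k hk1 hk4 horb
    exact D.reduce.compile_supports D.reduced_reduce hEs D.reduce_args_injective hn hk1 hk4 horb

/-- **Dawar–Wilsenach 2025, Theorem 6.4, PROVED**: the named fact
`DawarWilsenach2025_orbitSize_countingWidth` holds — orbit size `2^{o(n)}` of a family of
square-symmetric threshold circuits deciding a graph class forces counting width `o(n)`.  Proof as
printed (pp. 17–18): rigidify (`exists_reduced_rigidification_supports`, orbit size `+ n²` is still
`2^{o(n)}`, `eventually_add_sq_le_two_rpow`), extract `k = o(n)` with `ORB ≤ C(n, k)`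
(`eventually_exists_le_choose_of_subexponential`), apply the Support Theorem, and translate supports
of size `o(n)` into `≡^{C^k}`-invariance (`DawarWilsenach2025_countingWidth_littleO_of_supportSize_littleO`,
i.e. `[2, Thm. 6]`). [cite: DawarWilsenach2025, Thm. 6.4 (proof, pp. 17–18)] -/
theorem DawarWilsenach2025_orbitSize_countingWidth_holds : DawarWilsenach2025_orbitSize_countingWidth := by
  intro 𝒞 C hC hdec horb ε hε
  choose C' hC' using fun n => exists_reduced_rigidification_supports (C n) (hC n).1 (hC n).2.1
  have hdec' : DecidesGraphClass 𝒞 C' := by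
    intro n G _
    rw [(hC' n).2.2.1]
    exact hdec n G
  have horb' : ∀ δ : ℝ, 0 < δ →
      ∀ᶠ n : ℕ in atTop, ((C' n).orbitSize Set.univ : ℝ) ≤ (2 : ℝ) ^ (δ * (n : ℝ)) := by
    intro δ hδ
    filter_upwards [eventually_add_sq_le_two_rpow horb hδ] with n hn
    exact le_trans (by exact_mod_cast (hC' n).2.2.2.1) hn
  refine DawarWilsenach2025_countingWidth_littleO_of_supportSize_littleO
    (fun n => ⟨(hC' n).1, (hC' n).2.1⟩) hdec' (fun δ hδ => ?_) hε
  have hδ' : 0 < min δ (1 / 8) := lt_min hδ (by norm_num)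
  filter_upwards [eventually_exists_le_choose_of_subexponential horb' hδ', eventually_gt_atTop 8]
    with n hn hn8 j
  obtain ⟨k, hk1, -, hkδ, hks⟩ := hn
  have hkδn : (k : ℝ) ≤ δ * n :=
    hkδ.trans (mul_le_mul_of_nonneg_right (min_le_left _ _) (Nat.cast_nonneg n))
  have h8k : 8 * k ≤ n := by
    have h : (8 : ℝ) * k ≤ n := by
      have := hkδ.trans (mul_le_mul_of_nonneg_right (min_le_right _ _) (Nat.cast_nonneg n))
      linarith
    exact_mod_cast h
  have hk4 : k + 1 ≤ n / 4 := (Nat.le_div_iff_mul_le (by norm_num)).2 (by omega)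
  obtain ⟨S, hS, hsup⟩ := (hC' n).2.2.2.2 hn8 k hk1 hk4 hks j
  exact ⟨S, le_trans (by exact_mod_cast hS) hkδn, hsup⟩

end Discharge

/-! ## The boundary example: the literal reading of Thm. 6.2 fails for the tree's circuits

The circuit `DiagonalReader.circuit` on `9 × 9` matrix inputs: nine gates `∧₁(x_{uu})`
(`u ∈ Fin 9`) followed by their disjunction (the output). It is a simply wired, rigid,
`Sym(Fin 9)`-symmetric `tcBasis`-circuit of orbit size at most `9 = (9 choose 1)`, and its gate
`∧₁(x_{00})` is moved by the automorphism extending the transposition `(0 1)`, so it has no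
support of size `0`: the statement "order `n > 8`, `1 ≤ k ≤ n/4`, orbit size `≤ (n choose k)` ⇒
every gate has a support of size `< k`" is false at `n = 9`, `k = 1`
(`DiagonalReader.not_supportTheorem_literal`). This is why the conditional theorems above take
Thm. 6.2 in the form "… `k + 1 ≤ n/4` … ⇒ a support of size `≤ k`". Throughout, gates are
handled through their NUMBER (`Fin.val`), the gate list being `List.ofFn gateAt`. -/

namespace DiagonalReader

/-- The gate `∧₁(x_{uu})` reading the diagonal input `(u, u)`. [folklore] -/
def inGate (u : Fin 9) : Gate (Fin 9 × Fin 9) := ⟨1, (GateFn.and 1).2, fun _ => Sum.inl (u, u)⟩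

/-- The disjunction `∨₉` of the gate wires `0, …, 8`. [folklore] -/
def orGate : Gate (Fin 9 × Fin 9) := ⟨9, (GateFn.or 9).2, fun i => Sum.inr (i : ℕ)⟩

/-- Gate number `j`: `∧₁(x_{jj})` for `j < 9`, the disjunction for `j = 9`. [folklore] -/
def gateAt (j : Fin 10) : Gate (Fin 9 × Fin 9) :=
  if h : (j : ℕ) < 9 then inGate ⟨j, h⟩ else orGate

/-- `gateAt j = ∧₁(x_{jj})` for `j < 9`. [folklore] -/
theorem gateAt_of_lt (j : ℕ) (hj : j < 10) (h : j < 9) : gateAt ⟨j, hj⟩ = inGate ⟨j, h⟩ :=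
  dif_pos h

/-- `gateAt 9` is the disjunction. [folklore] -/
theorem gateAt_of_not_lt (j : ℕ) (hj : j < 10) (h : ¬ j < 9) : gateAt ⟨j, hj⟩ = orGate :=
  dif_neg h

/-- Gate number `j` only reads gate wires `m < j` (in fact only the disjunction reads gate
wires, namely `0, …, 8`). [folklore] -/
theorem gateAt_wf : ∀ j : Fin 10, ∀ a : Fin (gateAt j).arity,
    ∀ m ∈ ((gateAt j).args a).getRight?, m < (j : ℕ) := by
  decide

/-- **The diagonal reader**: gates `∧₁(x_{00}), …, ∧₁(x_{88})` and, as output, their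
disjunction. [folklore] -/
def circuit : Circuit (Fin 9 × Fin 9) where
  gates := List.ofFn gateAt
  output := Sum.inr 9
  wf j hj a m hm := by
    revert a
    rw [List.getElem_ofFn]
    intro a hm
    exact gateAt_wf _ a m (Sum.getRight?_eq_some_iff.2 hm)
  wf_output m hm := by
    cases hm
    simp

/-- The diagonal reader has `10` gates. [folklore] -/
theorem length_gates : circuit.gates.length = 10 := by
  simp [circuit]

/-- Gate `i` of the diagonal reader is `gateAt i`. [folklore] -/
theorem gates_eq {i : ℕ} (hi : i < circuit.gates.length) :
    circuit.gates[i] = gateAt ⟨i, length_gates ▸ hi⟩ :=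
  List.getElem_ofFn hi

/-- A gate of the diagonal reader is `∧₁(x_{ii})` if its number `i` is `< 9` … [folklore] -/
theorem gates_eq_inGate (i : Fin circuit.gates.length) (hi : (i : ℕ) < 9) :
    circuit.gates[i] = inGate ⟨i, hi⟩ := by
  rw [Fin.getElem_fin, gates_eq, gateAt_of_lt _ _ hi]

/-- … and the disjunction otherwise. [folklore] -/
theorem gates_eq_orGate (i : Fin circuit.gates.length) (hi : ¬ (i : ℕ) < 9) :
    circuit.gates[i] = orGate := by
  rw [Fin.getElem_fin, gates_eq, gateAt_of_not_lt _ _ hi]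

/-- An automorphism (extending any map of the inputs) fixes the disjunction, the only gate of
arity `9`. [folklore] -/
theorem aut_val_of_not_lt {π : Fin 9 × Fin 9 → Fin 9 × Fin 9}
    {σ : Equiv.Perm (Fin circuit.gates.length)} (h : circuit.IsInducedAut π σ)
    {i : Fin circuit.gates.length} (hi : ¬ (i : ℕ) < 9) : ((σ i : Fin _) : ℕ) = i := by
  have har : (circuit.gates[σ i]).arity = (circuit.gates[i]).arity := congrArg Sigma.fst (h.2 i).1
  rw [gates_eq_orGate i hi] at har
  by_cases hσ : ((σ i : Fin _) : ℕ) < 9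
  · rw [gates_eq_inGate _ hσ] at har
    simp [inGate, orGate] at har
  · have h1 : ((σ i : Fin _) : ℕ) < 10 := length_gates ▸ (σ i).2
    have h2 : (i : ℕ) < 10 := length_gates ▸ i.2
    omega

/-- An automorphism extending `π` maps `∧₁(x_{uu})` to the gate `∧₁(x_{vv})` with
`(v, v) = π (u, u)`. [folklore] -/
theorem aut_val_of_lt {π : Fin 9 × Fin 9 → Fin 9 × Fin 9}
    {σ : Equiv.Perm (Fin circuit.gates.length)} (h : circuit.IsInducedAut π σ)
    {i : Fin circuit.gates.length} (hi : (i : ℕ) < 9) :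
    ∃ hv : ((σ i : Fin _) : ℕ) < 9,
      (Sum.inl ((⟨_, hv⟩ : Fin 9), (⟨_, hv⟩ : Fin 9)) : (Fin 9 × Fin 9) ⊕ ℕ) =
        Sum.inl (π (⟨i, hi⟩, ⟨i, hi⟩)) := by
  obtain ⟨hfn, hperm⟩ := h.2 i
  have har : (circuit.gates[σ i]).arity = (circuit.gates[i]).arity := congrArg Sigma.fst hfn
  rw [gates_eq_inGate i hi] at har
  have hv : ((σ i : Fin _) : ℕ) < 9 := by
    by_contra hv
    rw [gates_eq_orGate _ hv] at har
    simp [inGate, orGate] at har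
  refine ⟨hv, ?_⟩
  rw [gates_eq_inGate _ hv, gates_eq_inGate i hi] at hperm
  simpa [inGate, List.ofFn_succ] using hperm

/-- **The diagonal reader is rigid**: an automorphism is determined by the map of the inputs it
extends (the disjunction is the only gate of arity `9`; the image of `∧₁(x_{uu})` reads
`π(u, u)`). [folklore] -/
theorem isRigid : circuit.IsRigid := by
  intro π σ σ' h h'
  refine Equiv.ext fun i => Fin.ext ?_
  by_cases hi : (i : ℕ) < 9
  · obtain ⟨hv, hvu⟩ := aut_val_of_lt h hi
    obtain ⟨hv', hv'u⟩ := aut_val_of_lt h' hi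
    have hpair := Sum.inl.inj (hvu.trans hv'u.symm)
    have hval := Fin.val_eq_of_eq (Prod.mk.inj hpair).1
    exact hval
  · rw [aut_val_of_not_lt h hi, aut_val_of_not_lt h' hi]

/-- The extension of `ρ ∈ Sym(Fin 9)` to the gate numbers `0, …, 9` (the last fixed).
[folklore] -/
def ext10 (ρ : Equiv.Perm (Fin 9)) : Equiv.Perm (Fin 10) :=
  finSuccEquivLast.trans ((Equiv.optionCongr ρ).trans finSuccEquivLast.symm)

/-- The extension of `ρ ∈ Sym(Fin 9)` to the gates of the diagonal reader:
`∧₁(x_{uu}) ↦ ∧₁(x_{ρu ρu})`, the disjunction fixed. [folklore] -/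
def ext (ρ : Equiv.Perm (Fin 9)) : Equiv.Perm (Fin circuit.gates.length) :=
  (finCongr length_gates).trans ((ext10 ρ).trans (finCongr length_gates.symm))

/-- `ext10 ρ` fixes `9`. [folklore] -/
theorem ext10_last (ρ : Equiv.Perm (Fin 9)) : ext10 ρ (Fin.last 9) = Fin.last 9 := by
  rw [ext10, Equiv.trans_apply, Equiv.trans_apply, finSuccEquivLast_last, Equiv.optionCongr_apply,
    Option.map_none, finSuccEquivLast_symm_none]

/-- `ext10 ρ (castSucc u) = castSucc (ρ u)`. [folklore] -/
theorem ext10_castSucc (ρ : Equiv.Perm (Fin 9)) (u : Fin 9) :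
    ext10 ρ (Fin.castSucc u) = Fin.castSucc (ρ u) := by
  simp [ext10, finSuccEquivLast_castSucc, finSuccEquivLast_symm_some]

/-- The value of `ext ρ` on a gate `∧₁(x_{ii})`. [folklore] -/
theorem ext_val_of_lt (ρ : Equiv.Perm (Fin 9)) {i : Fin circuit.gates.length} (hi : (i : ℕ) < 9) :
    ((ext ρ i : Fin _) : ℕ) = ρ ⟨i, hi⟩ := by
  have hcast : Fin.cast length_gates i = Fin.castSucc ⟨i, hi⟩ := Fin.ext rfl
  show ((ext10 ρ (Fin.cast length_gates i) : Fin 10) : ℕ) = _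
  rw [hcast, ext10_castSucc, Fin.val_castSucc]

/-- `ext ρ` fixes the disjunction. [folklore] -/
theorem ext_val_of_not_lt (ρ : Equiv.Perm (Fin 9)) {i : Fin circuit.gates.length}
    (hi : ¬ (i : ℕ) < 9) : ((ext ρ i : Fin _) : ℕ) = i := by
  have h2 : (i : ℕ) < 10 := length_gates ▸ i.2
  have hi9 : (i : ℕ) = 9 := by omega
  have hcast : Fin.cast length_gates i = Fin.last 9 := Fin.ext hi9
  show ((ext10 ρ (Fin.cast length_gates i) : Fin 10) : ℕ) = _
  rw [hcast, ext10_last, hi9]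
  rfl

/-- **The diagonal reader is `Sym(Fin 9)`-symmetric**: `ext ρ` is an automorphism extending the
diagonal action of `ρ`. [folklore] -/
theorem isInducedAut_ext (ρ : Equiv.Perm (Fin 9)) :
    circuit.IsInducedAut (fun q : Fin 9 × Fin 9 => (ρ q.1, ρ q.2)) (ext ρ) := by
  have h9 : 9 < circuit.gates.length := by
    rw [length_gates]
    decide
  refine ⟨?_, fun j => ?_⟩
  · show Sum.inr (Circuit.relabelGate (ext ρ) 9) = Sum.inr 9
    rw [Circuit.relabelGate_of_lt _ h9]
    exact congrArg Sum.inr (ext_val_of_not_lt ρ (i := ⟨9, h9⟩) (Nat.lt_irrefl 9))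
  · -- at a general image index `i = ext ρ j`
    suffices key : ∀ i : Fin circuit.gates.length, i = ext ρ j →
        ((circuit.gates[i]).fn = (circuit.gates[j]).fn ∧
          (List.ofFn (circuit.gates[i]).args).Perm
            ((List.ofFn (circuit.gates[j]).args).map
              (Circuit.relabelWire (fun q : Fin 9 × Fin 9 => (ρ q.1, ρ q.2)) (ext ρ)))) from
      key _ rfl
    intro i hi
    by_cases hj : (j : ℕ) < 9
    · have hival : (i : ℕ) = ρ ⟨j, hj⟩ := by
        rw [hi]
        exact ext_val_of_lt ρ hj
      have hvi : (i : ℕ) < 9 := hival ▸ (ρ ⟨j, hj⟩).2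
      have e1 : circuit.gates[i] = inGate (ρ ⟨j, hj⟩) := by
        rw [gates_eq_inGate i hvi]
        exact congrArg inGate (Fin.ext hival)
      rw [e1, gates_eq_inGate j hj]
      refine ⟨rfl, ?_⟩
      simp only [inGate, List.ofFn_succ, List.ofFn_zero, List.map_cons, List.map_nil,
        Circuit.relabelWire_inl]
      exact List.Perm.refl _
    · have hij : i = j := hi.trans (Fin.ext (ext_val_of_not_lt ρ hj))
      subst hij
      rw [gates_eq_orGate i hj]
      refine ⟨rfl, ?_⟩
      rw [List.map_ofFn]
      have hrel : (Circuit.relabelWire (fun q : Fin 9 × Fin 9 => (ρ q.1, ρ q.2)) (ext ρ) ∘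
          orGate.args) = fun u : Fin 9 => (Sum.inr ((ρ u : Fin 9) : ℕ) : (Fin 9 × Fin 9) ⊕ ℕ) := by
        funext u
        have hu9 : (u : ℕ) < 9 := u.2
        have hu : (u : ℕ) < circuit.gates.length := by
          rw [length_gates]
          omega
        simp only [Function.comp_apply, orGate, Circuit.relabelWire_inr, Sum.inr.injEq]
        rw [Circuit.relabelGate_of_lt _ hu, ext_val_of_lt ρ (i := ⟨u, hu⟩) hu9]
        exact congrArg (fun x : Fin 9 => ((ρ x : Fin 9) : ℕ)) (Fin.ext rfl)
      rw [hrel]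
      exact (Equiv.Perm.ofFn_comp_perm ρ
        (fun u : Fin 9 => (Sum.inr (u : ℕ) : (Fin 9 × Fin 9) ⊕ ℕ))).symm

/-- The diagonal reader is symmetric under all of `Sym(Fin 9)`. [folklore] -/
theorem isSymmetricUnder : circuit.IsSymmetricUnder Set.univ :=
  fun ρ _ => ⟨ext ρ, isInducedAut_ext ρ⟩

/-- The diagonal reader is a `tcBasis`-circuit (`∧₁, ∨₉ ∈ acBasis ⊆ tcBasis`). [folklore] -/
theorem isOver : circuit.IsOver tcBasis := by
  intro g hg
  obtain ⟨x, rfl⟩ := List.mem_ofFn.1 hg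
  obtain ⟨x, hx10⟩ := x
  by_cases hx : x < 9
  · rw [gateAt_of_lt x hx10 hx]
    exact acBasis_subset_tcBasis (Or.inr (Set.mem_iUnion.2 ⟨1, Or.inl rfl⟩))
  · rw [gateAt_of_not_lt x hx10 hx]
    exact acBasis_subset_tcBasis (Or.inr (Set.mem_iUnion.2 ⟨9, Or.inr rfl⟩))

/-- The diagonal reader is simply wired. [folklore] -/
theorem hasSimpleWiring : circuit.HasSimpleWiring := by
  intro j
  by_cases hj : (j : ℕ) < 9
  · rw [gates_eq_inGate j hj]
    intro a b _
    exact @Subsingleton.elim (Fin 1) inferInstance a b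
  · rw [gates_eq_orGate j hj]
    intro a b hab
    exact Fin.ext (Sum.inr.inj hab)

/-- Every orbit of the diagonal reader has at most `9` gates: the disjunction is fixed by all
automorphisms, and the nine gates `∧₁(x_{uu})` are permuted among themselves. [folklore] -/
theorem orbitSize_le : circuit.orbitSize Set.univ ≤ 9 := by
  refine Finset.sup_le fun j _ => ?_
  by_cases hj : (j : ℕ) < 9
  · have hsub : ∀ j' ∈ circuit.gateOrbit Set.univ j, ((j' : Fin _) : ℕ) ∈
        ((Finset.range 9 : Finset ℕ) : Set ℕ) := by
      rintro j' ⟨ρ, -, σ, hσ, rfl⟩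
      obtain ⟨hv, -⟩ := aut_val_of_lt hσ hj
      simpa using hv
    refine (Set.ncard_le_ncard_of_injOn (fun j' : Fin circuit.gates.length => (j' : ℕ)) hsub
      (fun a _ b _ hab => Fin.ext hab) (Finset.finite_toSet _)).trans ?_
    rw [Set.ncard_coe_finset, Finset.card_range]
  · have hsub : circuit.gateOrbit Set.univ j ⊆ {j} := by
      rintro j' ⟨ρ, -, σ, hσ, rfl⟩
      exact Fin.ext (aut_val_of_not_lt hσ hj)
    refine (Set.ncard_le_ncard hsub (Set.toFinite _)).trans ?_
    rw [Set.ncard_singleton]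
    decide

/-- **The literal reading of Dawar–Wilsenach 2025, Thm. 6.2 is false for the tree's circuits**:
it is NOT the case that every simply wired, rigid, `Sym(Fin n)`-symmetric `tcBasis`-circuit of
order `n > 8` with orbit size at most `(n choose k)`, `1 ≤ k ≤ n/4`, has supports of size LESS
than `k` at every gate — witness the diagonal reader (`n = 9`, `k = 1`): the empty set does not
support `∧₁(x_{00})`, which the automorphism extending `(0 1)` moves to `∧₁(x_{11})`. Hence the
form "`k + 1 ≤ n/4` … support of size `≤ k`" used in the conditional theorems above. [folklore] -/
theorem not_supportTheorem_literal :
    ¬ ∀ (n : ℕ) (C : Circuit (Fin n × Fin n)), 8 < n → C.IsOver tcBasis →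
      C.IsSymmetricUnder Set.univ → C.IsRigid → C.HasSimpleWiring →
      ∀ k : ℕ, 1 ≤ k → k ≤ n / 4 → C.orbitSize Set.univ ≤ n.choose k →
      ∀ j : Fin C.gates.length, ∃ S : Finset (Fin n), S.card < k ∧
        C.Supports Set.univ (S : Set (Fin n)) j := by
  intro h
  have h0 : 0 < circuit.gates.length := by
    rw [length_gates]
    decide
  obtain ⟨S, hS, hsup⟩ := h 9 circuit (by norm_num) isOver isSymmetricUnder isRigid
    hasSimpleWiring 1 le_rfl (by norm_num) (by simpa using orbitSize_le) ⟨0, h0⟩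
  have hS0 : S = ∅ := Finset.card_eq_zero.1 (by omega)
  subst hS0
  obtain ⟨-, σ, hσ, hfix⟩ := hsup (Equiv.swap 0 1) (Set.mem_univ _) (by simp)
  obtain ⟨hv, hvu⟩ := aut_val_of_lt hσ (i := ⟨0, h0⟩) (Nat.succ_pos 8)
  have h1 := congrArg (fun p : Fin 9 × Fin 9 => (p.1 : ℕ)) (Sum.inl.inj hvu)
  dsimp only at h1
  rw [hfix] at h1
  change (0 : ℕ) = ((Equiv.swap (0 : Fin 9) 1 0 : Fin 9) : ℕ) at h1
  rw [Equiv.swap_apply_left] at h1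
  exact absurd h1 (by decide)

end DiagonalReader

end Literature.ModelTheory.FiniteModelTheory
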